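import Literature.Geometry.Lorentzian.KerrRedShiftEstimate
import Literature.Geometry.Lorentzian.KerrAxialKillingField
import Literature.Geometry.Lorentzian.KerrSchildMultiplierCoercivity
import Literature.Geometry.Lorentzian.KerrTimelikeSpan
import HarnessLib

/-!
# The energy estimate of the vector fields `T + Ω(r)Φ`, Killing on a radial shell, for functions
# supported in a radial slab (Dafermos–Rodnianski–Shlapentokh-Rothman, Prop. 13.1.2)

(family `gr`; namespaces `Literature.Geometry.Lorentzian.Kerr`, `.KerrSchild.Background`; written
from the proving seat of the named fact
`DafermosRodnianskiShlapentokhRothman2016_energyBoundedness_horizonRegular`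
(`KerrHorizonRegularWaveBoundedness.lean`); no named facts are introduced (D-0026).)

DRSR arXiv:1402.7034 = Ann. of Math. 183 (2016), §13.1.4, Prop. 13.1.2, bound the energy of the
frequency-localised pieces `ψ̃_i` of the cut-off solution `ψ̃ = χ_{[A₀,A₁]}ψ` (`□_g ψ̃_i = F̃_i`,
supported in `r ∈ [A₀, A₁]`) by "the energy identity associated to `V_i` in between the
hypersurfaces `Σ_τ` and `Σ_{τ_n^{(i)}}`", where `V_i` is "a `φ_τ`-invariant timelike vector field on
`𝓡` which is Killing in the region `r ∈ [3M − s⁻ + (i−1)ε, 3M − s⁻ + iε)`", built from the fact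
(Lemma 4.7.1, `Kerr.bilin_drsrVector_neg` of `KerrTimelikeSpan.lean`) that
`T + (2Mar/(r² + a²)²)Φ` is timelike off the horizon. This file proves that energy identity, as a
two-sided energy *estimate*, in the ingoing Kerr–Schild chart and in the multiplier framework of
`KerrSchildMultiplierCurrent.lean`, for the vector fields `X = T + Ω(r)Φ` with an arbitrary `C¹`
angular-velocity profile `Ω` of the Kerr–Schild radius:

* `Kerr.multiplierBulk_axialComponents_eq_zero` — **`K^Φ = 0`**: the axial Killing field
  `Φ = x₁∂₂ − x₂∂₁` has no bulk term (the `α`-derivative at `0` of the axial invariance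
  `g⁻¹(R_α x) = R_α g⁻¹(x) R_αᵀ` of `KerrAxialSymmetry.lean`);
* `Kerr.multiplierBulk_helicalVector` — **`K^{T+Ω(r)Φ} = Ω'(r) (A·dr) Φ(w)`**: the bulk of
  `T + Ω(r)Φ` is proportional to `Ω'(r)`, so it vanishes on a shell where `Ω` is constant (`T`, `Φ`
  Killing, `Φ(r) = 0`), and `Kerr.exists_abs_multiplierBulk_helicalVector_le` — it is bounded by
  `|Ω'(r)| C ∑(∂w)²` on a slab `{A₀ ≤ r ≤ A₁}`, `A₀ > r₊`;
* `KerrSchild.Background.toBilin'_inverseMetric_pos_of_orthogonal_dt` — the strict cone structure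
  (`G > 0` on `dt^⊥ ∖ 0`) of a Kerr–Schild background, the input of the strict dominant energy
  condition `KerrSchild.dec_bilin_pos`;
* `Kerr.exists_helicalEnergy_coercive`, `Kerr.exists_abs_helicalFlux_le` — on the slab, if
  `T + Ω(r)Φ` is timelike and `|Ω(r)|√(r² + a²) < 1` (co-orientation `n(X) > 0`), its energy density
  through the leaves of slope `≤ 1 − c` is comparable to `∑(∂w)²`, uniformly (compactness of
  `{x⁰ = 0} ∩ slab × conormals`, stationarity) — "`J^{V_i}_μ n^μ ∼ J^N_μ n^μ`" of loc. cit.;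
* `Kerr.shell_helicalEnergy_estimate` — **the estimate**: there are `b > 0`, `C ≥ 0` such that for
  every `C²` height `F` of slope `∑(∂_iF)² ≤ (1 − c)²`, every `w ∈ C²(ℝ⁴)` vanishing off the slab
  and all `τ`, `s ≥ 0`, with `E(t) = ∫ ∑_μ(∂_μw)²(t + F(y), y) dy`,
  `b E(τ + s) ≤ C E(τ) + C Err` and `b E(τ) ≤ C E(τ + s) + C Err`,
  `Err = ∫_{(τ,τ+s]} ∫ (|□_g w| ∑_μ|∂_μw| + |Ω'(r)| ∑_μ(∂_μw)²)(u + F(y), y) dy du`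
  (`E4.graphFlux_add_integral_le_of_divergence_le` for `∓J^X[w]`). No equation is assumed for `w`:
  `□_g w` (`KerrSchild.waveOperator (Kerr.inverseMetric M a) w`, the divergence form, `det g = −1`)
  enters as a source, as for the inhomogeneous pieces `ψ̃_i` of loc. cit.

## References

* M. Dafermos, I. Rodnianski, Y. Shlapentokh-Rothman, *Decay for solutions of the wave equation on
  Kerr exterior spacetimes III: the full subextremal case `|a| < M`*, Ann. of Math. 183 (2016)
  787–913, arXiv:1402.7034: §2.2.2, §2.3.1–§2.3.2 (currents, `K^X`), Lemma 4.7.1, §13.1.4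
  Prop. 13.1.2 (key `DafermosRodnianskiShlapentokhrothman2014`).
* M. Dafermos, I. Rodnianski, *Lectures on black holes and linear waves*, arXiv:0811.0354, App. D
  (key `DafermosRodnianski2008`).
* S. W. Hawking, G. F. R. Ellis, *The large scale structure of space-time*, CUP 1973, §4.3 (dominant
  energy condition) (key `HawkingEllis1973CUP`).
* B. O'Neill, *The geometry of Kerr black holes*, A K Peters 1995, Ch. 2, §2.2 (`∂_φ` Killing)
  (key `ONeill1995`).
* R. P. Kerr, A. Schild, 1965, §2 (key `KerrSchild1965`).
-/

noncomputable section

open Set Filter Metric MeasureTheory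
open scoped Topology Manifold ContDiff ENNReal

namespace Literature.Geometry.Lorentzian

namespace Kerr

variable {M a : ℝ} {x : E4}

/-! ## Part 1. The axial Killing field has no bulk: `K^Φ = 0` -/

/-- The components of the axial field as a multiplier: `Φ^α(y) = (J y)^α = (0, −y₂, y₁, 0)`.
[cite: DafermosRodnianskiShlapentokhrothman2014, §2.2.2] -/
def axialComponents (y : E4) (α : Fin 4) : ℝ := E4.axialGenerator y α

/-- The axial multiplier components are the components of `Kerr.axialVector`. [folklore] -/
theorem axialComponents_eq_axialVector (y : E4) (α : Fin 4) :
    axialComponents y α = axialVector y α := by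
  rw [axialComponents, E4.axialGenerator_apply]
  rfl

/-- `y ↦ Φ^α(y)` is a continuous linear function, hence its own derivative. [folklore] -/
theorem fderiv_axialComponents (y v : E4) (α : Fin 4) :
    fderiv ℝ (fun z ↦ axialComponents z α) y v = E4.axialGenerator v α := by
  have h : (fun z ↦ axialComponents z α) =
      fun z ↦ ((EuclideanSpace.proj α : E4 →L[ℝ] ℝ).comp E4.axialGenerator) z := by
    funext z
    simp [axialComponents]
  rw [h, ContinuousLinearMap.fderiv]
  simp

/-- The axial components are smooth (linear). [folklore] -/
theorem contDiff_axialComponents (α : Fin 4) {n : WithTop ℕ∞} :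
    ContDiff ℝ n fun z ↦ axialComponents z α := by
  have h : (fun z ↦ axialComponents z α) =
      fun z ↦ ((EuclideanSpace.proj α : E4 →L[ℝ] ℝ).comp E4.axialGenerator) z := by
    funext z
    simp [axialComponents]
  rw [h]
  exact ContinuousLinearMap.contDiff _

/-- The generator on the coordinate vectors: `J ∂₀ = 0`, `J ∂₁ = ∂₂`, `J ∂₂ = −∂₁`, `J ∂₃ = 0`,
componentwise. [folklore] -/
theorem axialGenerator_basisVector_apply (μ κ : Fin 4) :
    E4.axialGenerator (E4.basisVector μ) κ =
      if μ = 1 ∧ κ = 2 then 1 else if μ = 2 ∧ κ = 1 then -1 else 0 := by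
  fin_cases μ <;> fin_cases κ <;> simp [E4.axialGenerator_apply, E4.basisVector]

/-- **Infinitesimal axial invariance of the inverse Kerr metric**: for every covector `p`,
`∑_{αβ} (∂_{Jx} g^{αβ}) p_α p_β = 2 ∑_{μν} g^{μν} q_μ p_ν` with `q_μ = ∑_κ p_κ (J ∂_μ)^κ`
(the `s`-derivative at `0` of `g⁻¹(R_s x) = R_s g⁻¹(x) R_sᵀ`, `Kerr.sum_inverseMetric_axialRotation`).
O'Neill 1995, Ch. 2, §2.2 (`∂_φ` is Killing). [cite: ONeill1995, Ch. 2 §2.2] -/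
theorem sum_fderiv_inverseMetric_axialGenerator (M a : ℝ) (hx : 0 < radius a x)
    (p : Fin 4 → ℝ) :
    ∑ α, ∑ β, fderiv ℝ (fun y ↦ inverseMetric M a y α β) x (E4.axialGenerator x) * p α * p β =
      2 * ∑ μ, ∑ ν, inverseMetric M a x μ ν *
        (∑ κ, p κ * E4.axialGenerator (E4.basisVector μ) κ) * p ν := by
  -- the functional `ℓ_p(v) = ∑ p_κ v^κ` and the bilinear form `B_p(u, v) = ℓ_p(u) ℓ_p(v)`
  set ℓ : E4 →L[ℝ] ℝ := ∑ κ, p κ • (EuclideanSpace.proj κ : E4 →L[ℝ] ℝ) with hℓ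
  have hℓapp : ∀ v : E4, ℓ v = ∑ κ, p κ * v κ := by
    intro v
    simp [hℓ]
  set B : E4 →L[ℝ] E4 →L[ℝ] ℝ := ℓ.smulRight ℓ with hB
  have hBapp : ∀ u v : E4, B u v = ℓ u * ℓ v := by
    intro u v
    simp [hB]
  have hℓe : ∀ μ, ℓ (E4.basisVector μ) = p μ := by
    intro μ
    rw [hℓapp]
    simp [E4.basisVector, Finset.sum_ite_eq']
  -- the two sides of the finite invariance as functions of the angle
  set φ : ℝ → ℝ := fun s ↦ ∑ μ, ∑ ν, inverseMetric M a (E4.axialRotation s x) μ ν * (p μ * p ν)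
    with hφ
  set ψ : ℝ → ℝ := fun s ↦ ∑ μ, ∑ ν, inverseMetric M a x μ ν *
    (ℓ (E4.axialRotation s (E4.basisVector μ)) * ℓ (E4.axialRotation s (E4.basisVector ν))) with hψ
  have hφψ : φ = ψ := by
    funext s
    have h := sum_inverseMetric_axialRotation M a s x B
    simp only [hBapp, hℓe] at h
    exact h
  -- derivative of `φ` at `0`
  have hc : HasDerivAt (fun s ↦ E4.axialRotation s x) (E4.axialGenerator x) 0 :=
    E4.hasDerivAt_axialRotation_zero x
  have hGd : ∀ μ ν, HasDerivAt (fun s ↦ inverseMetric M a (E4.axialRotation s x) μ ν)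
      (fderiv ℝ (fun y ↦ inverseMetric M a y μ ν) x (E4.axialGenerator x)) 0 := by
    intro μ ν
    have hd : DifferentiableAt ℝ (fun y ↦ inverseMetric M a y μ ν) (E4.axialRotation 0 x) := by
      rw [E4.axialRotation_zero_apply]
      exact (contDiffAt_inverseMetric M a hx μ ν (n := 1)).differentiableAt one_ne_zero
    have h := hd.hasFDerivAt.comp_hasDerivAt (0 : ℝ) hc
    rw [E4.axialRotation_zero_apply] at h
    exact h
  have hφd : HasDerivAt φ
      (∑ μ, ∑ ν, fderiv ℝ (fun y ↦ inverseMetric M a y μ ν) x (E4.axialGenerator x) *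
        (p μ * p ν)) 0 :=
    HasDerivAt.fun_sum fun μ _ ↦ HasDerivAt.fun_sum fun ν _ ↦ (hGd μ ν).mul_const (p μ * p ν)
  -- derivative of `ψ` at `0`
  have hRd : ∀ μ, HasDerivAt (fun s ↦ ℓ (E4.axialRotation s (E4.basisVector μ)))
      (ℓ (E4.axialGenerator (E4.basisVector μ))) 0 := fun μ ↦
    (ℓ.hasFDerivAt.comp_hasDerivAt (0 : ℝ) (E4.hasDerivAt_axialRotation_zero (E4.basisVector μ)))
  have hψd : HasDerivAt ψ
      (∑ μ, ∑ ν, inverseMetric M a x μ ν *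
        (ℓ (E4.axialGenerator (E4.basisVector μ)) * ℓ (E4.axialRotation 0 (E4.basisVector ν)) +
          ℓ (E4.axialRotation 0 (E4.basisVector μ)) * ℓ (E4.axialGenerator (E4.basisVector ν)))) 0 :=
    HasDerivAt.fun_sum fun μ _ ↦ HasDerivAt.fun_sum fun ν _ ↦
      ((hRd μ).fun_mul (hRd ν)).const_mul (inverseMetric M a x μ ν)
  rw [hφψ] at hφd
  have heq := hφd.unique hψd
  -- rewrite both sides in terms of `q_μ = ℓ_p(J ∂_μ)`
  set q : Fin 4 → ℝ := fun μ ↦ ∑ κ, p κ * E4.axialGenerator (E4.basisVector μ) κ with hq_def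
  have hq : ∀ μ, ℓ (E4.axialGenerator (E4.basisVector μ)) = q μ := fun μ ↦ hℓapp _
  simp only [E4.axialRotation_zero_apply, hℓe, hq] at heq
  have hL : ∑ α, ∑ β, fderiv ℝ (fun y ↦ inverseMetric M a y α β) x (E4.axialGenerator x) *
      p α * p β = ∑ μ, ∑ ν, fderiv ℝ (fun y ↦ inverseMetric M a y μ ν) x (E4.axialGenerator x) *
        (p μ * p ν) := by
    simp only [mul_assoc]
  have hR : 2 * ∑ μ, ∑ ν, inverseMetric M a x μ ν *
      (∑ κ, p κ * E4.axialGenerator (E4.basisVector μ) κ) * p ν =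
      2 * ∑ μ, ∑ ν, inverseMetric M a x μ ν * q μ * p ν := by
    simp only [hq_def]
  rw [hL, heq, hR]
  -- symmetrise
  have hsymm : ∀ μ ν, inverseMetric M a x μ ν = inverseMetric M a x ν μ := inverseMetric_symm M a x
  have h2 : ∑ μ, ∑ ν, inverseMetric M a x μ ν * (p μ * q ν) =
      ∑ μ, ∑ ν, inverseMetric M a x μ ν * (q μ * p ν) := by
    rw [Finset.sum_comm]
    refine Finset.sum_congr rfl fun μ _ ↦ Finset.sum_congr rfl fun ν _ ↦ ?_
    rw [hsymm ν μ]
    ring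
  have hsplit : ∑ μ, ∑ ν, inverseMetric M a x μ ν * (q μ * p ν + p μ * q ν) =
      ∑ μ, ∑ ν, inverseMetric M a x μ ν * (q μ * p ν) +
        ∑ μ, ∑ ν, inverseMetric M a x μ ν * (p μ * q ν) := by
    rw [← Finset.sum_add_distrib]
    refine Finset.sum_congr rfl fun μ _ ↦ ?_
    rw [← Finset.sum_add_distrib]
    refine Finset.sum_congr rfl fun ν _ ↦ ?_
    ring
  rw [hsplit, h2, two_mul]
  congr 1 <;> exact Finset.sum_congr rfl fun μ _ ↦ Finset.sum_congr rfl fun ν _ ↦ by ring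

/-- **`K^Φ = 0`: the axial Killing field has no bulk term** in the multiplier framework of
`KerrSchild.multiplierBulk` (coordinates with `det g = −1`, `div Φ = 0`): at every point with
`r > 0`, for every function `w`, `K^Φ[w] = 0` for the inverse Kerr metric. This is the
infinitesimal form of the axial symmetry (`∂_φ` is Killing; O'Neill 1995, Ch. 2, §2.2), used in
DRSR arXiv:1402.7034, §13.1.4 (the vector fields `V_i`, Killing on a radial shell).
[cite: DafermosRodnianskiShlapentokhrothman2014, §13.1.4] -/
theorem multiplierBulk_axialComponents_eq_zero (M a : ℝ) (hx : 0 < radius a x) (w : E4 → ℝ) :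
    KerrSchild.multiplierBulk (inverseMetric M a) axialComponents w x = 0 := by
  set p : Fin 4 → ℝ := fun κ ↦ fderiv ℝ w x (E4.basisVector κ) with hp_def
  have hp : ∀ κ, fderiv ℝ w x (E4.basisVector κ) = p κ := fun _ ↦ rfl
  have hinv := sum_fderiv_inverseMetric_axialGenerator M a hx p
  -- the directional derivative along `J x` as a combination of coordinate derivatives
  have hdir : ∀ α β, fderiv ℝ (fun y ↦ inverseMetric M a y α β) x (E4.axialGenerator x) =
      ∑ μ, axialComponents x μ *
        fderiv ℝ (fun y ↦ inverseMetric M a y α β) x (E4.basisVector μ) := by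
    intro α β
    conv_lhs => rw [eq_sum_basisVector (E4.axialGenerator x), map_sum]
    refine Finset.sum_congr rfl fun μ _ ↦ ?_
    rw [map_smul, smul_eq_mul]
    rfl
  unfold KerrSchild.multiplierBulk
  simp only [fderiv_axialComponents, hp]
  -- the third term equals the first by infinitesimal invariance
  have h3 : ∑ μ, axialComponents x μ * ∑ α, ∑ β,
      fderiv ℝ (fun y ↦ inverseMetric M a y α β) x (E4.basisVector μ) * p α * p β =
      ∑ α, ∑ β, fderiv ℝ (fun y ↦ inverseMetric M a y α β) x (E4.axialGenerator x) * p α * p β := by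
    simp only [hdir, Finset.mul_sum, Finset.sum_mul]
    rw [Finset.sum_comm]
    refine Finset.sum_congr rfl fun α _ ↦ ?_
    rw [Finset.sum_comm]
    refine Finset.sum_congr rfl fun β _ ↦ Finset.sum_congr rfl fun μ _ ↦ ?_
    ring
  rw [h3, hinv]
  simp only [axialGenerator_basisVector_apply, Fin.sum_univ_four, Fin.isValue]
  simp only [show (0 : Fin 4) ≠ 1 from by decide, show (0 : Fin 4) ≠ 2 from by decide,
    show (1 : Fin 4) ≠ 2 from by decide, show (2 : Fin 4) ≠ 1 from by decide,
    show (3 : Fin 4) ≠ 1 from by decide, show (3 : Fin 4) ≠ 2 from by decide,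
    and_true, and_false, if_true, if_false, and_self]
  ring


/-! ## Part 2. The multipliers `X = T + Ω(r) Φ` -/

/-- The vector `T + Ω(r) Φ = ∂₀ + Ω(r) (x₁ ∂₂ − x₂ ∂₁)` at `x`, for an angular-velocity profile
`Ω : ℝ → ℝ` of the Kerr–Schild radius (for constant `Ω` this is the helical Killing field
`T + ΩΦ`; for `Ω = 2Mar/(r² + a²)²` it is the timelike vector field of DRSR Lemma 4.7.1,
`Kerr.drsrVector`; the `V_i` of DRSR arXiv:1402.7034, Prop. 13.1.2 are of this form with `Ω`
constant on a radial shell). [cite: DafermosRodnianskiShlapentokhrothman2014, §13.1.4] -/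
def helicalVec (a : ℝ) (Ω : ℝ → ℝ) (x : E4) : E4 :=
  E4.basisVector 0 + Ω (radius a x) • axialVector x

/-- The components of `T + Ω(r) Φ` as a multiplier. [cite: DafermosRodnianskiShlapentokhrothman2014, §13.1.4] -/
def helicalVector (a : ℝ) (Ω : ℝ → ℝ) (x : E4) (α : Fin 4) : ℝ := helicalVec a Ω x α

/-- Components of `T + Ω(r)Φ`: `δ^α_0 + Ω(r) Φ^α`. [folklore] -/
theorem helicalVector_eq (a : ℝ) (Ω : ℝ → ℝ) (x : E4) (α : Fin 4) :
    helicalVector a Ω x α = (if α = 0 then 1 else 0) + Ω (radius a x) * axialComponents x α := by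
  rw [helicalVector, helicalVec, axialComponents_eq_axialVector]
  fin_cases α <;> simp [E4.basisVector]

/-- `(T + Ω(r)Φ)⁰ = 1`. [folklore] -/
@[simp] theorem helicalVector_apply_zero (a : ℝ) (Ω : ℝ → ℝ) (x : E4) :
    helicalVector a Ω x 0 = 1 := by
  simp [helicalVector_eq, axialComponents]

/-- `(T + Ω(r)Φ)¹ = −Ω(r) x₂`. [folklore] -/
theorem helicalVector_apply_one (a : ℝ) (Ω : ℝ → ℝ) (x : E4) :
    helicalVector a Ω x 1 = -(Ω (radius a x) * x 2) := by
  simp [helicalVector_eq, axialComponents]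

/-- `(T + Ω(r)Φ)² = Ω(r) x₁`. [folklore] -/
theorem helicalVector_apply_two (a : ℝ) (Ω : ℝ → ℝ) (x : E4) :
    helicalVector a Ω x 2 = Ω (radius a x) * x 1 := by
  simp [helicalVector_eq, axialComponents]

/-- `(T + Ω(r)Φ)³ = 0`. [folklore] -/
@[simp] theorem helicalVector_apply_three (a : ℝ) (Ω : ℝ → ℝ) (x : E4) :
    helicalVector a Ω x 3 = 0 := by
  simp [helicalVector_eq, axialComponents]

/-- `drsrVector` is the helical multiplier of the DRSR profile `Ω(r) = 2Mar/(r² + a²)²`.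
[cite: DafermosRodnianskiShlapentokhrothman2014, Lemma 4.7.1] -/
theorem helicalVec_drsrAngularVelocity (M a : ℝ) (x : E4) :
    helicalVec a (drsrAngularVelocity M a) x = drsrVector M a x := rfl

/-- The axial components are `t*`-independent. [folklore] -/
theorem axialComponents_add_smul_basisVector_zero (x : E4) (t : ℝ) (α : Fin 4) :
    axialComponents (x + t • E4.basisVector 0) α = axialComponents x α := by
  fin_cases α <;> simp [axialComponents, E4.axialGenerator_apply, E4.basisVector]

/-- The helical multipliers are `t*`-independent. [folklore] -/
theorem helicalVector_add_smul_basisVector_zero (a : ℝ) (Ω : ℝ → ℝ) (x : E4) (t : ℝ) (α : Fin 4) :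
    helicalVector a Ω (x + t • E4.basisVector 0) α = helicalVector a Ω x α := by
  rw [helicalVector_eq, helicalVector_eq, radius_add_time_smul_basisVector,
    axialComponents_add_smul_basisVector_zero]

/-- The helical vector fields are `t*`-independent. [folklore] -/
theorem helicalVec_add_smul_basisVector_zero (a : ℝ) (Ω : ℝ → ℝ) (x : E4) (t : ℝ) :
    helicalVec a Ω (x + t • E4.basisVector 0) = helicalVec a Ω x := by
  ext α
  exact helicalVector_add_smul_basisVector_zero a Ω x t α

/-- The components of `T + Ω(r)Φ` are `C¹` wherever `r > 0`, for a `C¹` profile. [folklore] -/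
theorem contDiffAt_helicalVector (a : ℝ) {Ω : ℝ → ℝ} (hΩ : ContDiff ℝ 1 Ω) (hx : 0 < radius a x)
    (α : Fin 4) : ContDiffAt ℝ 1 (fun y ↦ helicalVector a Ω y α) x := by
  have h : (fun y ↦ helicalVector a Ω y α) =
      fun y ↦ (if α = 0 then (1 : ℝ) else 0) + Ω (radius a y) * axialComponents y α :=
    funext fun y ↦ helicalVector_eq a Ω y α
  rw [h]
  exact contDiffAt_const.add ((hΩ.contDiffAt.comp x (contDiffAt_radius hx)).mul
    (contDiff_axialComponents α).contDiffAt)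

/-- The vector field `T + Ω(r)Φ` is continuous on `{r > 0}` for continuous `Ω`. [folklore] -/
theorem continuousOn_helicalVec (a : ℝ) {Ω : ℝ → ℝ} (hΩ : Continuous Ω) :
    ContinuousOn (helicalVec a Ω) {x | 0 < radius a x} := by
  intro x hx
  have hr : ContinuousAt (radius a) x := (contDiffAt_radius hx (n := 0)).continuousAt
  have hax : Continuous (axialVector : E4 → E4) := by
    have : (axialVector : E4 → E4) = fun y ↦ E4.axialGenerator y :=
      funext fun y ↦ by rw [E4.axialGenerator_apply]; rfl
    rw [this]
    exact E4.axialGenerator.continuous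
  exact (continuousAt_const.add ((hΩ.continuousAt.comp hr).smul hax.continuousAt)).continuousWithinAt

/-- **`Φ(r) = 0`**: the radius is axially symmetric, so its derivative along `J x` vanishes
(`Kerr.radius_axialRotation` differentiated at angle `0`). [folklore] -/
theorem fderiv_radius_axialGenerator (hx : 0 < radius a x) :
    fderiv ℝ (radius a) x (E4.axialGenerator x) = 0 := by
  have hc : HasDerivAt (fun s ↦ E4.axialRotation s x) (E4.axialGenerator x) 0 :=
    E4.hasDerivAt_axialRotation_zero x
  have hd : DifferentiableAt ℝ (radius a) (E4.axialRotation 0 x) := by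
    rw [E4.axialRotation_zero_apply]
    exact (contDiffAt_radius hx (n := 1)).differentiableAt one_ne_zero
  have h := hd.hasFDerivAt.comp_hasDerivAt (0 : ℝ) hc
  rw [E4.axialRotation_zero_apply] at h
  have hconst : (radius a ∘ fun s ↦ E4.axialRotation s x) = fun _ ↦ radius a x :=
    funext fun s ↦ radius_axialRotation a s x
  rw [hconst] at h
  exact h.unique (hasDerivAt_const 0 _) ▸ rfl

/-- **The bulk of `T + Ω(r)Φ`**: at a point with `r > 0`,
`K^{T + Ω(r)Φ}[w] = Ω'(r) (∑_μ A^μ ∂_μ r)(∑_α Φ^α ∂_αw)`, `A^μ = ∑_ν g^{μν} ∂_νw` — `T` and `Φ`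
are Killing (`K^T = 0` by stationarity, `K^Φ = 0` by `multiplierBulk_axialComponents_eq_zero`),
`Φ(Ω(r)) = 0`, and only the `T(∇(Ω∘r), Φ)`-term of `K^{fΦ} = fK^Φ + T(Φ, ∇f)` survives; it
vanishes where `Ω' = 0` (DRSR arXiv:1402.7034, Prop. 13.1.2: `V_i` Killing on the shell).
[cite: DafermosRodnianskiShlapentokhrothman2014, §13.1.4] -/
theorem multiplierBulk_helicalVector (M a : ℝ) {Ω : ℝ → ℝ} (hΩ : ContDiff ℝ 1 Ω)
    (hx : 0 < radius a x) (w : E4 → ℝ) :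
    KerrSchild.multiplierBulk (inverseMetric M a) (helicalVector a Ω) w x =
      deriv Ω (radius a x) *
        ((∑ μ, (∑ ν, inverseMetric M a x μ ν * fderiv ℝ w x (E4.basisVector ν)) *
            fderiv ℝ (radius a) x (E4.basisVector μ)) *
          ∑ α, axialComponents x α * fderiv ℝ w x (E4.basisVector α)) := by
  -- `X = T + f Φ` with `f = Ω ∘ r`
  set f : E4 → ℝ := fun y ↦ Ω (radius a y) with hf
  set T : E4 → Fin 4 → ℝ := fun _ α ↦ if α = 0 then 1 else 0 with hT
  set Y : E4 → Fin 4 → ℝ := fun y α ↦ f y * axialComponents y α with hY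
  have hX : helicalVector a Ω = T + Y := by
    funext y α
    rw [helicalVector_eq]
    rfl
  have hfd : DifferentiableAt ℝ f x :=
    ((hΩ.contDiffAt.comp x (contDiffAt_radius hx)).differentiableAt one_ne_zero)
  have hTd : ∀ α, DifferentiableAt ℝ (fun y ↦ T y α) x := fun α ↦ differentiableAt_const _
  have hΦd : ∀ α, DifferentiableAt ℝ (fun y ↦ axialComponents y α) x := fun α ↦
    ((contDiff_axialComponents α (n := 1)).differentiable one_ne_zero) x
  have hYd : ∀ α, DifferentiableAt ℝ (fun y ↦ Y y α) x := fun α ↦ hfd.mul (hΦd α)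
  rw [hX, KerrSchild.multiplierBulk_add _ w hTd hYd]
  -- `K^T = 0`
  have hKT : KerrSchild.multiplierBulk (inverseMetric M a) T w x = 0 := by
    rw [KerrSchild.multiplierBulk_of_fderiv_eq_zero _ w (fun α ↦ by
      show fderiv ℝ (fun _ : E4 ↦ if α = 0 then (1 : ℝ) else 0) x = 0
      exact fderiv_const_apply _)]
    simp [hT, Fin.sum_univ_succ, fderiv_inverseMetric_basisVector_zero M a hx]
  -- `K^{fΦ} = f K^Φ + (A·df) Φ(w) − ½ Φ(f) Q`
  have hKY := KerrSchild.multiplierBulk_smul (inverseMetric M a) w hfd hΦd (X := axialComponents)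
  have hKΦ := multiplierBulk_axialComponents_eq_zero M a hx w
  -- `Φ(f) = Ω'(r) dr(J x) = 0` and `df = Ω'(r) dr`
  have hdf : ∀ v, fderiv ℝ f x v = deriv Ω (radius a x) * fderiv ℝ (radius a) x v := by
    intro v
    have h1 : HasFDerivAt (radius a) (fderiv ℝ (radius a) x) x :=
      ((contDiffAt_radius hx (n := 1)).differentiableAt one_ne_zero).hasFDerivAt
    have h2 : HasDerivAt Ω (deriv Ω (radius a x)) (radius a x) :=
      ((hΩ.differentiable one_ne_zero) _).hasDerivAt
    have h := h2.comp_hasFDerivAt x h1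
    rw [show f = Ω ∘ radius a from rfl, h.fderiv]
    simp [smul_eq_mul]
  have hΦf : ∑ μ, axialComponents x μ * fderiv ℝ f x (E4.basisVector μ) = 0 := by
    have h1 : ∑ μ, axialComponents x μ * fderiv ℝ f x (E4.basisVector μ) =
        fderiv ℝ f x (E4.axialGenerator x) := by
      conv_rhs => rw [eq_sum_basisVector (E4.axialGenerator x), map_sum]
      refine Finset.sum_congr rfl fun μ _ ↦ ?_
      rw [map_smul, smul_eq_mul]
      rfl
    rw [h1, hdf, fderiv_radius_axialGenerator hx, mul_zero]
  have hYdef : (fun y α ↦ f y * axialComponents y α) = Y := rfl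
  rw [hYdef] at hKY
  rw [hKT, zero_add, hKY, hKΦ, mul_zero, zero_add, hΦf]
  simp only [hdf, mul_zero, zero_mul, sub_zero]
  have hpull : ∑ μ, (∑ ν, inverseMetric M a x μ ν * fderiv ℝ w x (E4.basisVector ν)) *
      (deriv Ω (radius a x) * fderiv ℝ (radius a) x (E4.basisVector μ)) =
      deriv Ω (radius a x) * ∑ μ, (∑ ν, inverseMetric M a x μ ν * fderiv ℝ w x (E4.basisVector ν)) *
        fderiv ℝ (radius a) x (E4.basisVector μ) := by
    rw [Finset.mul_sum]
    exact Finset.sum_congr rfl fun μ _ ↦ by ring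
  rw [hpull]
  ring

end Kerr

/-! ## Part 3. Cone structure: strict positivity on `dt^⊥`, lowered covectors, conormals -/

namespace KerrSchild.Background

/-- **The bilinear form of a background in components**:
`G(v, w) = −v₀w₀ + v⃗·w⃗ − φ (l·v)(l·w)`. [cite: KerrSchild1965, §2] -/
theorem toBilin'_inverseMetric_eq (B : Background) (x : E4) (v w : Fin 4 → ℝ) :
    Matrix.toBilin' (B.inverseMetric x) v w =
      -(v 0 * w 0) + v 1 * w 1 + v 2 * w 2 + v 3 * w 3 -
        B.φ x * ((B.l x 0 * v 0 + B.l x 1 * v 1 + B.l x 2 * v 2 + B.l x 3 * v 3) *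
          (B.l x 0 * w 0 + B.l x 1 * w 1 + B.l x 2 * w 2 + B.l x 3 * w 3)) := by
  simp only [Matrix.toBilin'_apply, Background.inverseMetric, KerrSchild.inverseMetric,
    Kerr.etaComp, Fin.sum_univ_four, Fin.isValue]
  simp only [show (1 : Fin 4) ≠ 0 from by decide, show (2 : Fin 4) ≠ 0 from by decide,
    show (3 : Fin 4) ≠ 0 from by decide, show (0 : Fin 4) ≠ 1 from by decide,
    show (0 : Fin 4) ≠ 2 from by decide, show (0 : Fin 4) ≠ 3 from by decide,
    show (1 : Fin 4) ≠ 2 from by decide, show (1 : Fin 4) ≠ 3 from by decide,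
    show (2 : Fin 4) ≠ 1 from by decide, show (2 : Fin 4) ≠ 3 from by decide,
    show (3 : Fin 4) ≠ 1 from by decide, show (3 : Fin 4) ≠ 2 from by decide, if_true, if_false]
  ring

/-- The algebraic core of the strict cone structure: with `|l⃗| = 1`, `l⁰ = −1`, `φ ≥ 0`,
`G(dt, u) = 0` reads `u₀ = φ s`, `s = l·u`, and then `(1 + φ) G(u, u) ≥ |u⃗|²`. [folklore] -/
private theorem strict_cone_aux {u0 u1 u2 u3 l1 l2 l3 f : ℝ} (hf : 0 ≤ f)
    (hsph : l1 ^ 2 + l2 ^ 2 + l3 ^ 2 = 1)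
    (hu : u0 = f * (-u0 + (l1 * u1 + l2 * u2 + l3 * u3))) :
    u1 ^ 2 + u2 ^ 2 + u3 ^ 2 ≤ (1 + f) *
      (-u0 ^ 2 + (u1 ^ 2 + u2 ^ 2 + u3 ^ 2) - f * (-u0 + (l1 * u1 + l2 * u2 + l3 * u3)) ^ 2) := by
  have hL : l1 * u1 + l2 * u2 + l3 * u3 = (1 + f) * (-u0 + (l1 * u1 + l2 * u2 + l3 * u3)) := by
    linear_combination hu
  have hCS : (l1 * u1 + l2 * u2 + l3 * u3) ^ 2 ≤ u1 ^ 2 + u2 ^ 2 + u3 ^ 2 := by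
    nlinarith [sq_nonneg (l1 * u2 - l2 * u1), sq_nonneg (l1 * u3 - l3 * u1),
      sq_nonneg (l2 * u3 - l3 * u2), hsph]
  have hCS' : ((1 + f) * (-u0 + (l1 * u1 + l2 * u2 + l3 * u3))) ^ 2 ≤ u1 ^ 2 + u2 ^ 2 + u3 ^ 2 := by
    rw [← hL]; exact hCS
  have hid : (1 + f) * (-u0 ^ 2 + (u1 ^ 2 + u2 ^ 2 + u3 ^ 2) -
      f * (-u0 + (l1 * u1 + l2 * u2 + l3 * u3)) ^ 2) =
      (1 + f) * (u1 ^ 2 + u2 ^ 2 + u3 ^ 2) -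
        f * ((1 + f) * (-u0 + (l1 * u1 + l2 * u2 + l3 * u3))) ^ 2 := by
    have hu2 : u0 ^ 2 = (f * (-u0 + (l1 * u1 + l2 * u2 + l3 * u3))) ^ 2 := by rw [← hu]
    linear_combination (1 + f) * (-1 : ℝ) * hu2
  rw [hid]
  nlinarith [mul_le_mul_of_nonneg_left hCS' hf]
set_option maxHeartbeats 400000 in -- buildfix (bf3-g26): 160k/180k FAIL, 200k PASS at accept time; line-neutral budget line
/-- **Strict Lorentzian cone structure of a background**: `G > 0` on `dt^⊥ ∖ {0}` (for
`G(dt, u) = 0`: `(1 + φ) G(u, u) ≥ |u⃗|²`, and `u⃗ = 0` forces `u = 0`). [cite: KerrSchild1965, §2] -/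
theorem toBilin'_inverseMetric_pos_of_orthogonal_dt (B : Background) (x : E4) (u : Fin 4 → ℝ)
    (hu : Matrix.toBilin' (B.inverseMetric x) (fun α ↦ if α = 0 then (1 : ℝ) else 0) u = 0)
    (hne : u ≠ 0) : 0 < Matrix.toBilin' (B.inverseMetric x) u u := by
  rw [toBilin'_inverseMetric_eq] at hu ⊢
  simp only [Fin.isValue, if_true, show (1 : Fin 4) ≠ 0 from by decide,
    show (2 : Fin 4) ≠ 0 from by decide, show (3 : Fin 4) ≠ 0 from by decide, if_false,
    mul_one, mul_zero, add_zero] at hu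
  -- `u ≠ 0`: some component is nonzero
  have hne' : u 0 ≠ 0 ∨ u 1 ≠ 0 ∨ u 2 ≠ 0 ∨ u 3 ≠ 0 := by
    by_contra h
    push Not at h
    apply hne
    funext i
    fin_cases i
    · exact h.1
    · exact h.2.1
    · exact h.2.2.1
    · exact h.2.2.2
  have hf0 : 0 ≤ B.φ x := B.φ_nonneg x
  by_cases hφ : B.φ x = 0
  · -- Minkowski at `x`: `u₀ = 0` and `G(u,u) = |u⃗|² > 0`
    rw [hφ] at hu ⊢
    have hu0 : u 0 = 0 := by linarith
    rw [hu0] at hne' ⊢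
    rcases hne' with h | h | h | h
    · exact absurd rfl h
    · have := sq_pos_of_ne_zero h; nlinarith [sq_nonneg (u 2), sq_nonneg (u 3)]
    · have := sq_pos_of_ne_zero h; nlinarith [sq_nonneg (u 1), sq_nonneg (u 3)]
    · have := sq_pos_of_ne_zero h; nlinarith [sq_nonneg (u 1), sq_nonneg (u 2)]
  · have hnorm := B.normalised x hφ
    have hnull := B.null x hφ
    rw [Minkowski.bilin_symm, Minkowski.bilin_basisVector_zero_left] at hnorm
    have h0 : B.l x 0 = -1 := by linarith
    have hsph : B.l x 1 ^ 2 + B.l x 2 ^ 2 + B.l x 3 ^ 2 = 1 := by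
      simp only [Minkowski.bilin_apply, Fin.sum_univ_three, Fin.isValue, Fin.succ_zero_eq_one,
        Fin.succ_one_eq_two, h0] at hnull
      have h3 : (Fin.succ 2 : Fin 4) = 3 := rfl
      rw [h3] at hnull
      nlinarith [hnull]
    rw [h0] at hu ⊢
    have hu' : u 0 = B.φ x * (-u 0 + (B.l x 1 * u 1 + B.l x 2 * u 2 + B.l x 3 * u 3)) := by
      linarith
    have hcore := strict_cone_aux hf0 hsph hu'
    -- the spatial part is nonzero
    have hU : 0 < u 1 ^ 2 + u 2 ^ 2 + u 3 ^ 2 := by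
      by_contra hz
      rw [not_lt] at hz
      have h1 : u 1 = 0 := by nlinarith [sq_nonneg (u 1), sq_nonneg (u 2), sq_nonneg (u 3)]
      have h2 : u 2 = 0 := by nlinarith [sq_nonneg (u 1), sq_nonneg (u 2), sq_nonneg (u 3)]
      have h3 : u 3 = 0 := by nlinarith [sq_nonneg (u 1), sq_nonneg (u 2), sq_nonneg (u 3)]
      rw [h1, h2, h3] at hu'
      have hu0 : u 0 * (1 + B.φ x) = 0 := by linear_combination hu'
      have hu0' : u 0 = 0 := by
        rcases mul_eq_zero.mp hu0 with h | h
        · exact h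
        · linarith
      rcases hne' with h | h | h | h
      · exact h hu0'
      · exact h h1
      · exact h h2
      · exact h h3
    have hpos : 0 < (1 + B.φ x) * (-u 0 ^ 2 + (u 1 ^ 2 + u 2 ^ 2 + u 3 ^ 2) -
        B.φ x * (-u 0 + (B.l x 1 * u 1 + B.l x 2 * u 2 + B.l x 3 * u 3)) ^ 2) :=
      hU.trans_le hcore
    have h1f : 0 < 1 + B.φ x := by linarith
    have hq := (pos_iff_pos_of_mul_pos hpos).mp h1f
    linarith [hq]

end KerrSchild.Background

namespace Kerr

variable {M a : ℝ} {x : E4}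

/-- **The lowered covector `ξ = g(X, ·)`** of a vector `X ∈ E4` at `x`: `ξ_β = g_x(X, ∂_β)`.
[cite: DafermosRodnianski2008, App. D] -/
def lower (M a : ℝ) (x X : E4) : Fin 4 → ℝ := fun β ↦ bilin M a x X (E4.basisVector β)

/-- **`X = g⁻¹ ξ`**: `X^α = ∑_β g^{αβ} ξ_β` wherever `r > 0`. [cite: DafermosRodnianski2008, App. D] -/
theorem eq_sum_inverseMetric_mul_lower (M a : ℝ) (hx : 0 < radius a x) (X : E4) (α : Fin 4) :
    X α = ∑ β, inverseMetric M a x α β * lower M a x X β := by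
  have hξ : ∀ β, lower M a x X β = ∑ γ, X γ * bilin M a x (E4.basisVector γ) (E4.basisVector β) :=
    fun β ↦ bilin_eq_sum_apply M a x X (E4.basisVector β)
  simp only [hξ, Finset.mul_sum]
  rw [Finset.sum_comm]
  have h : ∀ γ, ∑ β, inverseMetric M a x α β * (X γ * bilin M a x (E4.basisVector γ) (E4.basisVector β))
      = X γ * if α = γ then 1 else 0 := by
    intro γ
    rw [← sum_inverseMetric_mul_bilin M a hx α γ, Finset.mul_sum]
    exact Finset.sum_congr rfl fun β _ ↦ by rw [bilin_symm M a x (E4.basisVector γ)]; ring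
  simp only [h, mul_ite, mul_one, mul_zero, Finset.sum_ite_eq, Finset.mem_univ, if_true]

/-- **`G(ξ, n) = n(X)`** for the lowered covector. [cite: DafermosRodnianski2008, App. D] -/
theorem toBilin'_inverseMetric_lower (M a : ℝ) (hx : 0 < radius a x) (X : E4) (n : Fin 4 → ℝ) :
    Matrix.toBilin' (inverseMetric M a x) (lower M a x X) n = ∑ μ, n μ * X μ := by
  rw [Matrix.toBilin'_apply, Finset.sum_comm]
  refine Finset.sum_congr rfl fun μ _ ↦ ?_
  rw [eq_sum_inverseMetric_mul_lower M a hx X μ, Finset.mul_sum]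
  exact Finset.sum_congr rfl fun β _ ↦ by rw [inverseMetric_symm M a x μ β]; ring

/-- **`G(ξ, ξ) = g(X, X)`** for the lowered covector. [cite: DafermosRodnianski2008, App. D] -/
theorem toBilin'_inverseMetric_lower_self (M a : ℝ) (hx : 0 < radius a x) (X : E4) :
    Matrix.toBilin' (inverseMetric M a x) (lower M a x X) (lower M a x X) = bilin M a x X X := by
  rw [toBilin'_inverseMetric_lower M a hx]
  have h : bilin M a x X X = bilin M a x X (∑ μ, X μ • E4.basisVector μ) :=
    congrArg (bilin M a x X) (eq_sum_basisVector X)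
  rw [h, map_sum]
  refine Finset.sum_congr rfl fun μ _ ↦ ?_
  rw [map_smul, smul_eq_mul, lower]
  ring

/-- The lowered covector of a `t*`-invariant vector is `t*`-invariant. [folklore] -/
theorem lower_add_smul_basisVector_zero (M a : ℝ) (x X : E4) (t : ℝ) :
    lower M a (x + t • E4.basisVector 0) X = lower M a x X := by
  funext β
  simp only [lower, bilin_add_smul_basisVector_zero]

/-- The lowered covector depends continuously on the point (on `{r > 0}`) for a vector field
continuous there. [folklore] -/
theorem continuousOn_lower (M : ℝ) {X : E4 → E4} (hX : ContinuousOn X {x : E4 | 0 < radius a x})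
    (β : Fin 4) : ContinuousOn (fun x ↦ lower M a x (X x) β) {x : E4 | 0 < radius a x} := by
  intro x hx
  have hb : ContinuousAt (bilin M a) x := (contDiffAt_bilin M a hx (n := 0)).continuousAt
  have h1 : ContinuousWithinAt (fun y ↦ bilin M a y (X y)) {x : E4 | 0 < radius a x} x :=
    hb.continuousWithinAt.clm_apply (hX x hx)
  exact h1.clm_apply continuousWithinAt_const

/-- **The spacelike conormals of slope at most `1 − c`**: `n = (1, −q)` with `|q|² ≤ (1 − c)²`
(the conormals `dt* − dF` of the graph leaves of slope `∑(∂_iF)² ≤ (1 − c)²`; DRSR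
arXiv:1402.7034, §3.3: admissible hypersurfaces are uniformly spacelike).
[cite: DafermosRodnianskiShlapentokhrothman2014, §3.3] -/
def slopeConormals (c : ℝ) : Set (Fin 4 → ℝ) :=
  {n | n 0 = 1 ∧ ∑ i : Fin 3, n i.succ ^ 2 ≤ (1 - c) ^ 2}

/-- Slope-`(1 − c)` conormals are admissible (`|n⃗| ≤ 1`) for `0 ≤ c ≤ 1`. [folklore] -/
theorem slopeConormals_subset_admissibleConormals {c : ℝ} (hc : 0 ≤ c) (hc1 : c ≤ 1) :
    slopeConormals c ⊆ admissibleConormals := fun n hn ↦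
  ⟨hn.1, hn.2.trans (by nlinarith)⟩

/-- The conormal `dt* − dF` of a graph leaf of slope `∑(∂_iF)² ≤ (1 − c)²` is a slope-`(1 − c)`
conormal. [folklore] -/
theorem graphConormal_mem_slopeConormals {F : E3 → ℝ} {y : E3} {c : ℝ}
    (hF : ∑ i, partialE3 F y i ^ 2 ≤ (1 - c) ^ 2) : graphConormal F y ∈ slopeConormals c :=
  ⟨graphConormal_zero F y, by simpa only [graphConormal_succ, neg_sq] using hF⟩

/-- The set of slope-`(1 − c)` conormals is compact (closed and bounded). [folklore] -/
theorem isCompact_slopeConormals (c : ℝ) : IsCompact (slopeConormals c) := by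
  refine Metric.isCompact_of_isClosed_isBounded ?_ ?_
  · rw [slopeConormals, Set.setOf_and]
    exact (isClosed_eq (continuous_apply 0) continuous_const).inter
      (isClosed_le (continuous_finsetSum _ fun i _ ↦ (continuous_apply _).pow 2) continuous_const)
  · rw [isBounded_iff_forall_norm_le]
    refine ⟨max (|1 - c|) 1, fun n hn ↦ ?_⟩
    rw [pi_norm_le_iff_of_nonneg (by positivity)]
    intro μ
    rw [Real.norm_eq_abs]
    refine Fin.cases ?_ (fun i ↦ ?_) μ
    · rw [hn.1, abs_one]; exact le_max_right _ _
    · have h : n i.succ ^ 2 ≤ (1 - c) ^ 2 :=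
        (Finset.single_le_sum (fun j _ ↦ sq_nonneg (n (Fin.succ j))) (Finset.mem_univ i)).trans hn.2
      exact (sq_le_sq.mp h).trans (le_max_left _ _)

/-- **Conormals of slope `≤ 1 − c` are strictly timelike covectors**: for `n = (1, −q)` with
`|q|² ≤ (1 − c)²`, `0 < c ≤ 1`, `M ≥ 0`: `G(n, n) = −1 + |q|² − 2H (ℓ♯(n))² ≤ −1 + (1 − c)² < 0`.
[cite: DafermosRodnianskiShlapentokhrothman2014, §3.3] -/
theorem toBilin'_inverseMetric_slopeConormal_neg (hM : 0 ≤ M) (a : ℝ) (x : E4) {c : ℝ}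
    (hc : 0 < c) (hc1 : c ≤ 1) {n : Fin 4 → ℝ} (hn : n ∈ slopeConormals c) :
    Matrix.toBilin' (inverseMetric M a x) n n < 0 := by
  obtain ⟨h0, hs⟩ := hn
  have hH := scalarH_nonneg hM a x
  have hc2 : (1 - c) ^ 2 < 1 := by nlinarith
  rw [Matrix.toBilin'_apply]
  simp only [inverseMetric_apply, Fin.sum_univ_four, Fin.isValue, h0]
  simp only [show (1 : Fin 4) ≠ 0 from by decide, show (2 : Fin 4) ≠ 0 from by decide,
    show (3 : Fin 4) ≠ 0 from by decide, show (0 : Fin 4) ≠ 1 from by decide,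
    show (0 : Fin 4) ≠ 2 from by decide, show (0 : Fin 4) ≠ 3 from by decide,
    show (1 : Fin 4) ≠ 2 from by decide, show (1 : Fin 4) ≠ 3 from by decide,
    show (2 : Fin 4) ≠ 1 from by decide, show (2 : Fin 4) ≠ 3 from by decide,
    show (3 : Fin 4) ≠ 1 from by decide, show (3 : Fin 4) ≠ 2 from by decide, if_true, if_false]
  rw [Fin.sum_univ_three] at hs
  simp only [Fin.succ_zero_eq_one, Fin.succ_one_eq_two] at hs
  rw [show ((2 : Fin 3).succ : Fin 4) = 3 from rfl] at hs
  set l0 := nullVector a x 0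
  set l1 := nullVector a x 1
  set l2 := nullVector a x 2
  set l3 := nullVector a x 3
  have hsq : 0 ≤ 2 * scalarH M a x * (l0 * 1 + l1 * n 1 + l2 * n 2 + l3 * n 3) ^ 2 := by positivity
  nlinarith [hsq]

/-- **`n(T + ΩΦ) = 1 + Ω(r) (x₁ n₂ − x₂ n₁)`** for a conormal with `n₀ = 1`. [folklore] -/
theorem sum_mul_helicalVector {n : Fin 4 → ℝ} (hn : n 0 = 1) (a : ℝ) (Ω : ℝ → ℝ) (x : E4) :
    ∑ μ, n μ * helicalVector a Ω x μ = 1 + Ω (radius a x) * (x 1 * n 2 - x 2 * n 1) := by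
  simp only [Fin.sum_univ_four, Fin.isValue, helicalVector_apply_zero, helicalVector_apply_one,
    helicalVector_apply_two, helicalVector_apply_three, hn]
  ring

/-- **Co-orientation**: for an admissible conormal (`n₀ = 1`, `|n⃗| ≤ 1`) and a point with `r > 0`,
`n(T + ΩΦ) ≥ 1 − |Ω(r)| √(r² + a²)` (`|x₁n₂ − x₂n₁| ≤ √(x₁² + x₂²) ≤ √(r² + a²)`).
[cite: DafermosRodnianskiShlapentokhrothman2014, §13.1.4] -/
theorem one_sub_le_sum_mul_helicalVector {n : Fin 4 → ℝ} (hn : n ∈ admissibleConormals) (Ω : ℝ → ℝ)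
    (hx : 0 < radius a x) :
    1 - |Ω (radius a x)| * √(radius a x ^ 2 + a ^ 2) ≤ ∑ μ, n μ * helicalVector a Ω x μ := by
  rw [sum_mul_helicalVector hn.1]
  have hn2 : n 1 ^ 2 + n 2 ^ 2 ≤ 1 := by
    have h := hn.2
    rw [Fin.sum_univ_three] at h
    simp only [Fin.succ_zero_eq_one, Fin.succ_one_eq_two] at h
    nlinarith [sq_nonneg (n (Fin.succ 2))]
  have hx2 : x 1 ^ 2 + x 2 ^ 2 ≤ radius a x ^ 2 + a ^ 2 := sq_add_sq_le_radius_sq_add hx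
  have hdet : (x 1 * n 2 - x 2 * n 1) ^ 2 ≤ radius a x ^ 2 + a ^ 2 := by
    have h1 : (x 1 * n 2 - x 2 * n 1) ^ 2 ≤ (x 1 ^ 2 + x 2 ^ 2) * (n 1 ^ 2 + n 2 ^ 2) := by
      nlinarith [sq_nonneg (x 1 * n 1 + x 2 * n 2)]
    have h2 : (x 1 ^ 2 + x 2 ^ 2) * (n 1 ^ 2 + n 2 ^ 2) ≤ (radius a x ^ 2 + a ^ 2) * 1 :=
      mul_le_mul hx2 hn2 (by positivity) (by positivity)
    linarith
  have habs : |x 1 * n 2 - x 2 * n 1| ≤ √(radius a x ^ 2 + a ^ 2) := by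
    rw [← Real.sqrt_sq_eq_abs]
    exact Real.sqrt_le_sqrt hdet
  have h3 : |Ω (radius a x) * (x 1 * n 2 - x 2 * n 1)| ≤ |Ω (radius a x)| * √(radius a x ^ 2 + a ^ 2) := by
    rw [abs_mul]
    exact mul_le_mul_of_nonneg_left habs (abs_nonneg _)
  linarith [neg_abs_le (Ω (radius a x) * (x 1 * n 2 - x 2 * n 1))]


/-! ## Part 4. Uniform coercivity and boundedness of the `T + Ω(r)Φ`-energy on radial slabs -/

/-- Continuity of the matrix bilinear form in all its arguments along continuous data (finite sums
of products). [folklore] -/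
theorem continuousOn_toBilin' {α : Type*} [TopologicalSpace α] {S : Set α}
    {G : α → Fin 4 → Fin 4 → ℝ} {u v : α → Fin 4 → ℝ} (hG : ∀ i j, ContinuousOn (fun z ↦ G z i j) S)
    (hu : ∀ i, ContinuousOn (fun z ↦ u z i) S) (hv : ∀ i, ContinuousOn (fun z ↦ v z i) S) :
    ContinuousOn (fun z ↦ Matrix.toBilin' (G z) (u z) (v z)) S := by
  have h : (fun z ↦ Matrix.toBilin' (G z) (u z) (v z)) =
      fun z ↦ ∑ i, ∑ j, u z i * G z i j * v z j := by
    funext z; rw [Matrix.toBilin'_apply]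
  rw [h]
  exact continuousOn_finsetSum _ fun i _ ↦ continuousOn_finsetSum _ fun j _ ↦
    ((hu i).mul (hG i j)).mul (hv j)

/-- A `t*`-invariant function has `t*`-invariant derivative. [folklore] -/
theorem fderiv_add_smul_basisVector_zero_of_invariant {f : E4 → ℝ}
    (hf : ∀ (y : E4) (t : ℝ), f (y + t • E4.basisVector 0) = f y) (x : E4) (t : ℝ) :
    fderiv ℝ f (x + t • E4.basisVector 0) = fderiv ℝ f x := by
  have h : (fun y ↦ f (y + t • E4.basisVector 0)) = f := funext fun y ↦ hf y t
  rw [← fderiv_comp_add_right (t • E4.basisVector 0), h]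

/-- **Uniform coercivity of the `T + Ω(r)Φ`-energy through uniformly spacelike leaves on a radial
slab.** Let `(M, a)` be subextremal, `r₊ < A₀ ≤ A₁`, `Ω` continuous with `T + Ω(r)Φ` timelike on
`{A₀ ≤ r ≤ A₁}` and `|Ω(r)| √(r² + a²) < 1` there (co-orientation), and `0 < c ≤ 1`. Then there is
`b > 0` such that at every point of the slab, for every conormal `n = (1, −q)` with
`|q|² ≤ (1 − c)²` and every `w`, `b ∑_μ (∂_μw)² ≤ −∑_μ (J^X)^μ[w] n_μ`, `X = T + Ω(r)Φ`
(compactness of `{x⁰ = 0} ∩ slab × conormals`, stationarity, and the strict dominant energy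
condition `KerrSchild.dec_bilin_pos`). This is the comparability `J^{V_i}_μ n^μ ∼ J^N_μ n^μ` of
DRSR arXiv:1402.7034, Prop. 13.1.2 (lower half). [cite: DafermosRodnianskiShlapentokhrothman2014, §13.1.4] -/
theorem exists_helicalEnergy_coercive (hMa : IsSubextremal M a) {A₀ A₁ : ℝ} (hA₀ : rPlus M a < A₀)
    {Ω : ℝ → ℝ} (hΩ : Continuous Ω)
    (htl : ∀ x : E4, A₀ ≤ radius a x → radius a x ≤ A₁ →
      bilin M a x (helicalVec a Ω x) (helicalVec a Ω x) < 0)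
    (hco : ∀ r : ℝ, A₀ ≤ r → r ≤ A₁ → |Ω r| * √(r ^ 2 + a ^ 2) < 1)
    {c : ℝ} (hc : 0 < c) (hc1 : c ≤ 1) :
    ∃ b : ℝ, 0 < b ∧ ∀ x : E4, A₀ ≤ radius a x → radius a x ≤ A₁ →
      ∀ n ∈ slopeConormals c, ∀ w : E4 → ℝ,
        b * ∑ μ, fderiv ℝ w x (E4.basisVector μ) ^ 2 ≤
          -∑ μ, KerrSchild.multiplierCurrent (inverseMetric M a) (helicalVector a Ω) w x μ * n μ := by
  have hrp : 0 < rPlus M a := hMa.rPlus_pos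
  have hA₀pos : 0 < A₀ := hrp.trans hA₀
  set Bs := surgeryBackground M a (rPlus M a) hMa.pos.le hMa.rPlus_pos with hBs
  -- the quadratic form
  set ξ : E4 → Fin 4 → ℝ := fun x ↦ lower M a x (helicalVec a Ω x) with hξ
  set Q : (E4 × (Fin 4 → ℝ)) → (Fin 4 → ℝ) → ℝ := fun z p ↦
    -(Matrix.toBilin' (inverseMetric M a z.1) z.2 p * Matrix.toBilin' (inverseMetric M a z.1) (ξ z.1) p -
      2⁻¹ * Matrix.toBilin' (inverseMetric M a z.1) z.2 (ξ z.1) *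
        Matrix.toBilin' (inverseMetric M a z.1) p p) with hQ
  -- the compact parameter set
  set K₀ : Set E4 := {x | x 0 = 0 ∧ |radius a x - (A₀ + A₁) / 2| ≤ (A₁ - A₀) / 2} with hK₀
  have hK₀c : IsCompact K₀ := isCompact_timeZero_radius_slab a (by linarith)
  have hK₀r : ∀ x ∈ K₀, A₀ ≤ radius a x ∧ radius a x ≤ A₁ := fun x hx ↦ by
    have h := abs_le.mp hx.2
    constructor <;> linarith [h.1, h.2]
  set K : Set (E4 × (Fin 4 → ℝ)) := K₀ ×ˢ slopeConormals c with hK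
  have hKc : IsCompact K := hK₀c.prod (isCompact_slopeConormals c)
  -- positivity facts at slab points
  have hslab : ∀ x : E4, A₀ ≤ radius a x → radius a x ≤ A₁ → ∀ n ∈ slopeConormals c,
      ∀ p : Fin 4 → ℝ, p ≠ 0 → 0 < Q (x, n) p := by
    intro x h1 h2 n hn p hp
    have hxr : rPlus M a < radius a x := hA₀.trans_le h1
    have hxpos : 0 < radius a x := hrp.trans hxr
    have hsymm : ∀ μ ν, inverseMetric M a x μ ν = inverseMetric M a x ν μ := inverseMetric_symm M a x
    set Bf : LinearMap.BilinForm ℝ (Fin 4 → ℝ) := Matrix.toBilin' (inverseMetric M a x) with hBf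
    have hBsymm : ∀ u v, Bf u v = Bf v u := KerrSchild.toBilin'_symm _ hsymm
    -- `ξ` timelike
    have hξξ : Bf (ξ x) (ξ x) < 0 := by
      rw [hBf, hξ, toBilin'_inverseMetric_lower_self M a hxpos]
      exact htl x h1 h2
    -- strict positivity on `dt^⊥`, transported to `ξ^⊥`
    have hG : Bs.inverseMetric x = inverseMetric M a x :=
      surgeryBackground_inverseMetric_eq hMa.pos.le a hrp hxr.le
    have hdt : ∀ u, Bf (fun α ↦ if α = 0 then (1 : ℝ) else 0) u = 0 → u ≠ 0 → 0 < Bf u u := by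
      intro u hu hne
      have h := Bs.toBilin'_inverseMetric_pos_of_orthogonal_dt x u (by rw [hG]; exact hu) hne
      rwa [hG] at h
    have hposξ : ∀ u, Bf (ξ x) u = 0 → u ≠ 0 → 0 < Bf u u :=
      KerrSchild.pos_on_orthogonal_of_timelike Bf hBsymm hdt hξξ
    -- the conormal
    have hnn : Bf (-n) (-n) < 0 := by
      simp only [map_neg, LinearMap.neg_apply, neg_neg]
      exact toBilin'_inverseMetric_slopeConormal_neg hMa.pos.le a x hc hc1 hn
    have hna : n ∈ admissibleConormals := slopeConormals_subset_admissibleConormals hc.le hc1 hn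
    have hco' : Bf (ξ x) (-n) < 0 := by
      simp only [map_neg, neg_lt_zero]
      rw [hBf, hξ, toBilin'_inverseMetric_lower M a hxpos]
      have h3 := one_sub_le_sum_mul_helicalVector hna Ω hxpos (a := a) (x := x)
      have h4 := hco (radius a x) h1 h2
      have h5 : ∑ μ, n μ * helicalVec a Ω x μ = ∑ μ, n μ * helicalVector a Ω x μ := rfl
      rw [h5]
      linarith
    have hdec := KerrSchild.dec_bilin_pos Bf hBsymm (ξ x) (-n) p hξξ hposξ hnn hco' hp
    have hQeq : Q (x, n) p = Bf (-n) p * Bf (ξ x) p - 2⁻¹ * Bf (-n) (ξ x) * Bf p p := by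
      simp only [hQ, hBf, map_neg, LinearMap.neg_apply]
      ring
    rw [hQeq]
    exact hdec
  -- continuity of `Q` on `K × univ`
  have hKpos : ∀ z ∈ K ×ˢ (Set.univ : Set (Fin 4 → ℝ)), 0 < radius a z.1.1 := fun z hz ↦
    hA₀pos.trans_le (hK₀r _ hz.1.1).1
  have hp11 : Continuous fun z : (E4 × (Fin 4 → ℝ)) × (Fin 4 → ℝ) ↦ z.1.1 :=
    continuous_fst.comp continuous_fst
  have hGc : ∀ i j, ContinuousOn (fun z : (E4 × (Fin 4 → ℝ)) × (Fin 4 → ℝ) ↦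
      inverseMetric M a z.1.1 i j) (K ×ˢ Set.univ) := by
    intro i j z hz
    have h1 : ContinuousAt (fun y : E4 ↦ inverseMetric M a y i j) z.1.1 :=
      (contDiffAt_inverseMetric M a (hKpos z hz) i j (n := 0)).continuousAt
    exact (ContinuousAt.comp (f := fun z : (E4 × (Fin 4 → ℝ)) × (Fin 4 → ℝ) ↦ z.1.1)
      (g := fun y : E4 ↦ inverseMetric M a y i j) h1 hp11.continuousAt).continuousWithinAt
  have hOpen : IsOpen {x : E4 | 0 < radius a x} := isOpen_lt continuous_const (continuous_radius a)
  have hξc : ∀ i, ContinuousOn (fun z : (E4 × (Fin 4 → ℝ)) × (Fin 4 → ℝ) ↦ ξ z.1.1 i)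
      (K ×ˢ Set.univ) := by
    intro i z hz
    have h := continuousOn_lower M (continuousOn_helicalVec a hΩ) i (z.1.1) (hKpos z hz)
    have h1 : ContinuousAt (fun y : E4 ↦ ξ y i) z.1.1 := h.continuousAt (hOpen.mem_nhds (hKpos z hz))
    exact (ContinuousAt.comp (f := fun z : (E4 × (Fin 4 → ℝ)) × (Fin 4 → ℝ) ↦ z.1.1)
      (g := fun y : E4 ↦ ξ y i) h1 hp11.continuousAt).continuousWithinAt
  have hnc : ∀ i, ContinuousOn (fun z : (E4 × (Fin 4 → ℝ)) × (Fin 4 → ℝ) ↦ z.1.2 i)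
      (K ×ˢ Set.univ) := fun i ↦
    ((continuous_apply i).comp (continuous_snd.comp continuous_fst)).continuousOn
  have hpc : ∀ i, ContinuousOn (fun z : (E4 × (Fin 4 → ℝ)) × (Fin 4 → ℝ) ↦ z.2 i)
      (K ×ˢ Set.univ) := fun i ↦ ((continuous_apply i).comp continuous_snd).continuousOn
  have hQc : ContinuousOn (fun z : (E4 × (Fin 4 → ℝ)) × (Fin 4 → ℝ) ↦ Q z.1 z.2) (K ×ˢ Set.univ) := by
    simp only [hQ]
    exact (((continuousOn_toBilin' hGc hnc hpc).mul (continuousOn_toBilin' hGc hξc hpc)).sub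
      ((continuousOn_const.mul (continuousOn_toBilin' hGc hnc hξc)).mul
        (continuousOn_toBilin' hGc hpc hpc))).neg
  have hhom : ∀ z ∈ K, ∀ (t : ℝ) (p : Fin 4 → ℝ), Q z (t • p) = t ^ 2 * Q z p := by
    intro z _ t p
    simp only [hQ, map_smul, LinearMap.smul_apply, smul_eq_mul]
    ring
  have hposK : ∀ z ∈ K, ∀ p : Fin 4 → ℝ, p ≠ 0 → 0 < Q z p := by
    rintro ⟨x, n⟩ hz p hp
    exact hslab x (hK₀r x hz.1).1 (hK₀r x hz.1).2 n hz.2 p hp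
  obtain ⟨b, hb, hbQ⟩ := KerrSchild.exists_pos_mul_sum_sq_le hKc hQc hhom hposK
  refine ⟨b, hb, fun x h1 h2 n hn w ↦ ?_⟩
  -- translate to `x⁰ = 0`
  set x₀ : E4 := x + (-(x 0)) • E4.basisVector 0 with hx₀
  have hx₀0 : x₀ 0 = 0 := by simp [hx₀, E4.basisVector]
  have hx₀r : radius a x₀ = radius a x := radius_add_time_smul_basisVector a x _
  have hx₀K : x₀ ∈ K₀ := ⟨hx₀0, by rw [hx₀r]; exact abs_le.mpr ⟨by linarith, by linarith⟩⟩
  have hGx : inverseMetric M a x₀ = inverseMetric M a x := by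
    funext μ ν; exact inverseMetric_add_smul_basisVector_zero M a x _ μ ν
  have hξx : ξ x₀ = ξ x := by
    simp only [hξ, hx₀, helicalVec_add_smul_basisVector_zero, lower_add_smul_basisVector_zero]
  set p : Fin 4 → ℝ := fun κ ↦ fderiv ℝ w x (E4.basisVector κ) with hp
  have hQx : Q (x₀, n) p = Q (x, n) p := by simp only [hQ, hGx, hξx]
  have hb' := hbQ (x₀, n) ⟨hx₀K, hn⟩ p
  rw [hQx] at hb'
  -- the flux of `J^X` through `n`
  have hxpos : 0 < radius a x := hrp.trans (hA₀.trans_le h1)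
  have hX : ∀ α, helicalVector a Ω x α = ∑ β, inverseMetric M a x α β * ξ x β := fun α ↦
    eq_sum_inverseMetric_mul_lower M a hxpos (helicalVec a Ω x) α
  rw [KerrSchild.sum_multiplierCurrent_mul_eq w (inverseMetric_symm M a x) hX n]
  exact hb'

/-- **Boundedness of the `T + Ω(r)Φ`-flux density on a radial slab**: for `r₊ < A₀ ≤ A₁` and
continuous `Ω` there is `C ≥ 0` with `|∑_μ (J^X)^μ[w] n_μ| ≤ C ∑_μ (∂_μw)²` at every point of
`{A₀ ≤ r ≤ A₁}`, for every admissible conormal `n` (`n₀ = 1`, `|n⃗| ≤ 1`): the components of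
`X = T + Ω(r)Φ` are bounded on the slab (continuity, stationarity) and
`|(J^X)^μ| ≤ 6(1 + Φ)Ξ ∑(∂w)²`. The upper half of `J^{V_i}_μ n^μ ∼ J^N_μ n^μ`, DRSR
arXiv:1402.7034, Prop. 13.1.2. [cite: DafermosRodnianskiShlapentokhrothman2014, §13.1.4] -/
theorem exists_abs_helicalFlux_le (hMa : IsSubextremal M a) {A₀ A₁ : ℝ} (hA₀ : rPlus M a < A₀)
    {Ω : ℝ → ℝ} (hΩ : ContDiff ℝ 1 Ω) :
    ∃ C : ℝ, 0 ≤ C ∧ ∀ x : E4, A₀ ≤ radius a x → radius a x ≤ A₁ →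
      ∀ n ∈ admissibleConormals, ∀ w : E4 → ℝ,
        |∑ μ, KerrSchild.multiplierCurrent (inverseMetric M a) (helicalVector a Ω) w x μ * n μ| ≤
          C * ∑ μ, fderiv ℝ w x (E4.basisVector μ) ^ 2 := by
  have hrp : 0 < rPlus M a := hMa.rPlus_pos
  have hA₀pos : 0 < A₀ := hrp.trans hA₀
  set Bs := surgeryBackground M a (rPlus M a) hMa.pos.le hMa.rPlus_pos with hBs
  have hΦb0 : 0 ≤ Bs.bound := (Bs.φ_nonneg 0).trans (Bs.φ_le 0)
  -- bound of the components of `X` on the slab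
  have hΞ : ∀ α, ∃ C : ℝ, ∀ x : E4, A₀ ≤ radius a x → radius a x ≤ A₁ →
      |helicalVector a Ω x α| ≤ C := fun α ↦
    exists_forall_abs_le_of_continuousOn_slab a hA₀pos (fun x ↦ helicalVector a Ω x α)
      (fun x hx ↦ (contDiffAt_helicalVector a hΩ hx α).continuousAt.continuousWithinAt)
      (fun x t ↦ helicalVector_add_smul_basisVector_zero a Ω x t α)
  choose Cα hCα using hΞ
  set Ξ : ℝ := max 0 (Finset.univ.sup' Finset.univ_nonempty Cα) with hΞdef
  have hΞ0 : 0 ≤ Ξ := le_max_left _ _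
  have hΞb : ∀ x : E4, A₀ ≤ radius a x → radius a x ≤ A₁ → ∀ α, |helicalVector a Ω x α| ≤ Ξ :=
    fun x h1 h2 α ↦ (hCα α x h1 h2).trans
      ((Finset.le_sup' Cα (Finset.mem_univ α)).trans (le_max_right _ _))
  refine ⟨4 * (6 * (1 + Bs.bound) * Ξ), by positivity, fun x h1 h2 n hn w ↦ ?_⟩
  set S : ℝ := ∑ μ, fderiv ℝ w x (E4.basisVector μ) ^ 2 with hS
  have hS0 : 0 ≤ S := Finset.sum_nonneg fun μ _ ↦ sq_nonneg _
  have hxr : rPlus M a ≤ radius a x := (hA₀.trans_le h1).le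
  have hG : inverseMetric M a x = Bs.inverseMetric x :=
    (surgeryBackground_inverseMetric_eq hMa.pos.le a hrp hxr).symm
  have hJ : ∀ μ, KerrSchild.multiplierCurrent (inverseMetric M a) (helicalVector a Ω) w x μ =
      KerrSchild.multiplierCurrent Bs.inverseMetric (helicalVector a Ω) w x μ := fun μ ↦ by
    simp only [KerrSchild.multiplierCurrent, hG]
  have hJb : ∀ μ, |KerrSchild.multiplierCurrent Bs.inverseMetric (helicalVector a Ω) w x μ| ≤
      6 * (1 + Bs.bound) * Ξ * S := fun μ ↦ Bs.abs_multiplierCurrent_le w x (hΞb x h1 h2) μ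
  have hnb : ∀ μ, |n μ| ≤ 1 := abs_apply_le_one_of_mem_admissibleConormals hn
  calc |∑ μ, KerrSchild.multiplierCurrent (inverseMetric M a) (helicalVector a Ω) w x μ * n μ|
      ≤ ∑ μ, |KerrSchild.multiplierCurrent (inverseMetric M a) (helicalVector a Ω) w x μ * n μ| :=
        Finset.abs_sum_le_sum_abs _ _
    _ ≤ ∑ _μ : Fin 4, 6 * (1 + Bs.bound) * Ξ * S * 1 := Finset.sum_le_sum fun μ _ ↦ by
        rw [abs_mul, hJ μ]
        exact mul_le_mul (hJb μ) (hnb μ) (abs_nonneg _) (by positivity)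
    _ = 4 * (6 * (1 + Bs.bound) * Ξ) * S := by
        simp only [Finset.sum_const, Finset.card_univ, Fintype.card_fin, nsmul_eq_mul, Nat.cast_ofNat]
        ring


/-! ## Part 5. Regularity of the current; the size of the bulk -/

/-- A function which is `C¹` at the points of an open set `U` and vanishes off a closed `K ⊆ U`
is `C¹` on `ℝ⁴`. [folklore] -/
theorem contDiff_of_contDiffAt_of_eq_zero {f : E4 → ℝ} {K U : Set E4} (hK : IsClosed K)
    (hKU : K ⊆ U) (hf : ∀ x ∈ U, ContDiffAt ℝ 1 f x) (hz : ∀ x, x ∉ K → f x = 0) :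
    ContDiff ℝ 1 f := by
  refine contDiff_iff_contDiffAt.mpr fun x ↦ ?_
  by_cases hx : x ∈ U
  · exact hf x hx
  · have hxK : x ∉ K := fun h ↦ hx (hKU h)
    have hev : f =ᶠ[𝓝 x] fun _ ↦ 0 := by
      filter_upwards [hK.isOpen_compl.mem_nhds hxK] with y hy
      exact hz y hy
    exact (contDiffAt_const (c := (0 : ℝ))).congr_of_eventuallyEq hev

/-- A function which is continuous at the points of an open set `U` and vanishes off a closed
`K ⊆ U` is continuous on `ℝ⁴`. [folklore] -/
theorem continuous_of_continuousAt_of_eq_zero {f : E4 → ℝ} {K U : Set E4} (hK : IsClosed K)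
    (hKU : K ⊆ U) (hf : ∀ x ∈ U, ContinuousAt f x) (hz : ∀ x, x ∉ K → f x = 0) :
    Continuous f := by
  refine continuous_iff_continuousAt.mpr fun x ↦ ?_
  by_cases hx : x ∈ U
  · exact hf x hx
  · have hxK : x ∉ K := fun h ↦ hx (hKU h)
    have hev : f =ᶠ[𝓝 x] fun _ ↦ 0 := by
      filter_upwards [hK.isOpen_compl.mem_nhds hxK] with y hy
      exact hz y hy
    exact (continuousAt_const (y := (0 : ℝ))).congr_of_eventuallyEq hev

/-- The `T + Ω(r)Φ`-current of a `C²` function is `C¹` at points with `r > 0`. [folklore] -/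
theorem contDiffAt_helicalCurrent (M a : ℝ) {Ω : ℝ → ℝ} (hΩ : ContDiff ℝ 1 Ω) {w : E4 → ℝ}
    (hw : ContDiffAt ℝ 2 w x) (hx : 0 < radius a x) (μ : Fin 4) :
    ContDiffAt ℝ 1 (fun y ↦ KerrSchild.multiplierCurrent (inverseMetric M a) (helicalVector a Ω) w y μ)
      x := by
  have h2 : ContDiffAt ℝ ((1 : ℕ∞) + 1 : ℕ∞) w x := by exact_mod_cast hw
  have hp : ∀ ν, ContDiffAt ℝ 1 (fun y ↦ fderiv ℝ w y (E4.basisVector ν)) x := fun ν ↦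
    (h2.fderiv_right (m := 1) le_rfl).clm_apply contDiffAt_const
  have hg : ∀ α β, ContDiffAt ℝ 1 (fun y ↦ inverseMetric M a y α β) x := fun α β ↦
    contDiffAt_inverseMetric M a hx α β
  have hX : ∀ α, ContDiffAt ℝ 1 (fun y ↦ helicalVector a Ω y α) x := fun α ↦
    contDiffAt_helicalVector a hΩ hx α
  unfold KerrSchild.multiplierCurrent
  exact ((ContDiffAt.sum fun ν _ ↦ (hg μ ν).mul (hp ν)).mul
    (ContDiffAt.sum fun α _ ↦ (hX α).mul (hp α))).sub
    ((contDiffAt_const.mul (hX μ)).mul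
      (ContDiffAt.sum fun α _ ↦ ContDiffAt.sum fun β _ ↦ ((hg α β).mul (hp α)).mul (hp β)))

/-- The divergence-form wave operator of a `C²` function is continuous at points with `r > 0`.
[folklore] -/
theorem continuousAt_waveOperator (M a : ℝ) {w : E4 → ℝ} (hw : ContDiffAt ℝ 2 w x)
    (hx : 0 < radius a x) : ContinuousAt (KerrSchild.waveOperator (inverseMetric M a) w) x := by
  have h2 : ContDiffAt ℝ ((1 : ℕ∞) + 1 : ℕ∞) w x := by exact_mod_cast hw
  have hp : ∀ ν, ContDiffAt ℝ 1 (fun y ↦ fderiv ℝ w y (E4.basisVector ν)) x := fun ν ↦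
    (h2.fderiv_right (m := 1) le_rfl).clm_apply contDiffAt_const
  have hA : ∀ μ, ContDiffAt ℝ 1 (fun y ↦ ∑ ν, inverseMetric M a y μ ν * fderiv ℝ w y (E4.basisVector ν)) x :=
    fun μ ↦ ContDiffAt.sum fun ν _ ↦ (contDiffAt_inverseMetric M a hx μ ν).mul (hp ν)
  unfold KerrSchild.waveOperator
  refine tendsto_finsetSum _ fun μ _ ↦ ?_
  have h1 : ContDiffAt ℝ ((0 : ℕ∞) + 1 : ℕ∞)
      (fun y ↦ ∑ ν, inverseMetric M a y μ ν * fderiv ℝ w y (E4.basisVector ν)) x := by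
    exact_mod_cast hA μ
  exact ((h1.fderiv_right (m := 0) le_rfl).clm_apply contDiffAt_const).continuousAt

/-- **The size of the bulk of `T + Ω(r)Φ` on a radial slab**: for `r₊ < A₀` and `Ω ∈ C¹` there is
`C ≥ 0` with `|K^{T + Ω(r)Φ}[w](x)| ≤ |Ω'(r(x))| · C ∑_μ (∂_μw)²(x)` on `{A₀ ≤ r ≤ A₁}` (the
factors `A^μ`, `∂_μr`, `Φ^α` of `multiplierBulk_helicalVector` are bounded there). In particular
the bulk vanishes on a shell where `Ω` is constant (DRSR arXiv:1402.7034, Prop. 13.1.2).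
[cite: DafermosRodnianskiShlapentokhrothman2014, §13.1.4] -/
theorem exists_abs_multiplierBulk_helicalVector_le (hMa : IsSubextremal M a) {A₀ A₁ : ℝ}
    (hA₀ : rPlus M a < A₀) {Ω : ℝ → ℝ} (hΩ : ContDiff ℝ 1 Ω) :
    ∃ C : ℝ, 0 ≤ C ∧ ∀ x : E4, A₀ ≤ radius a x → radius a x ≤ A₁ → ∀ w : E4 → ℝ,
      |KerrSchild.multiplierBulk (inverseMetric M a) (helicalVector a Ω) w x| ≤
        |deriv Ω (radius a x)| * (C * ∑ μ, fderiv ℝ w x (E4.basisVector μ) ^ 2) := by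
  have hrp : 0 < rPlus M a := hMa.rPlus_pos
  have hA₀pos : 0 < A₀ := hrp.trans hA₀
  set Bs := surgeryBackground M a (rPlus M a) hMa.pos.le hMa.rPlus_pos with hBs
  have hΦb0 : 0 ≤ Bs.bound := (Bs.φ_nonneg 0).trans (Bs.φ_le 0)
  -- bounds for `∂_μ r` and `Φ^α` on the slab
  have hdr : ∀ μ, ∃ C : ℝ, ∀ x : E4, A₀ ≤ radius a x → radius a x ≤ A₁ →
      |fderiv ℝ (radius a) x (E4.basisVector μ)| ≤ C := fun μ ↦
    exists_forall_abs_le_of_continuousOn_slab a hA₀pos (fun x ↦ fderiv ℝ (radius a) x (E4.basisVector μ))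
      (fun x hx ↦ by
        have h1 : ContDiffAt ℝ ((0 : ℕ∞) + 1 : ℕ∞) (radius a) x := contDiffAt_radius hx
        exact ((h1.fderiv_right (m := 0) le_rfl).clm_apply contDiffAt_const).continuousAt.continuousWithinAt)
      (fun x t ↦ by rw [fderiv_add_smul_basisVector_zero_of_invariant
        (fun y s ↦ radius_add_time_smul_basisVector a y s)])
  choose Dr hDr using hdr
  set D : ℝ := max 0 (Finset.univ.sup' Finset.univ_nonempty Dr) with hDdef
  have hD0 : 0 ≤ D := le_max_left _ _
  have hDb : ∀ x : E4, A₀ ≤ radius a x → radius a x ≤ A₁ → ∀ μ,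
      |fderiv ℝ (radius a) x (E4.basisVector μ)| ≤ D := fun x h1 h2 μ ↦
    (hDr μ x h1 h2).trans ((Finset.le_sup' Dr (Finset.mem_univ μ)).trans (le_max_right _ _))
  have hax : ∀ α, ∃ C : ℝ, ∀ x : E4, A₀ ≤ radius a x → radius a x ≤ A₁ →
      |axialComponents x α| ≤ C := fun α ↦
    exists_forall_abs_le_of_continuousOn_slab a hA₀pos (fun x ↦ axialComponents x α)
      (fun x _ ↦ (contDiff_axialComponents α (n := 0)).continuous.continuousWithinAt)
      (fun x t ↦ axialComponents_add_smul_basisVector_zero x t α)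
  choose Xa hXa using hax
  set Ξ : ℝ := max 0 (Finset.univ.sup' Finset.univ_nonempty Xa) with hΞdef
  have hΞ0 : 0 ≤ Ξ := le_max_left _ _
  have hΞb : ∀ x : E4, A₀ ≤ radius a x → radius a x ≤ A₁ → ∀ α, |axialComponents x α| ≤ Ξ :=
    fun x h1 h2 α ↦ (hXa α x h1 h2).trans
      ((Finset.le_sup' Xa (Finset.mem_univ α)).trans (le_max_right _ _))
  refine ⟨16 * (1 + Bs.bound) * D * Ξ, by positivity, fun x h1 h2 w ↦ ?_⟩
  have hxr : rPlus M a ≤ radius a x := (hA₀.trans_le h1).le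
  have hxpos : 0 < radius a x := hrp.trans_le hxr
  rw [multiplierBulk_helicalVector M a hΩ hxpos w, abs_mul]
  refine mul_le_mul_of_nonneg_left ?_ (abs_nonneg _)
  -- name the atoms
  set p : Fin 4 → ℝ := fun κ ↦ fderiv ℝ w x (E4.basisVector κ) with hp
  set S : ℝ := ∑ κ, p κ ^ 2 with hS
  set T : ℝ := ∑ κ, |p κ| with hT
  have hT0 : 0 ≤ T := Finset.sum_nonneg fun _ _ ↦ abs_nonneg _
  have hsq : T ^ 2 ≤ 4 * S := sq_sum_abs_le_four_mul p
  have hG : ∀ α β, |inverseMetric M a x α β| ≤ 1 + Bs.bound := fun α β ↦ by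
    rw [← surgeryBackground_inverseMetric_eq hMa.pos.le a hrp hxr]
    exact Bs.abs_inverseMetric_le x α β
  have hAμ : ∀ μ, |∑ ν, inverseMetric M a x μ ν * p ν| ≤ (1 + Bs.bound) * T := by
    intro μ
    calc _ ≤ ∑ ν, |inverseMetric M a x μ ν * p ν| := Finset.abs_sum_le_sum_abs _ _
      _ ≤ ∑ ν, (1 + Bs.bound) * |p ν| := Finset.sum_le_sum fun ν _ ↦ by
          rw [abs_mul]; exact mul_le_mul_of_nonneg_right (hG μ ν) (abs_nonneg _)
      _ = (1 + Bs.bound) * T := by rw [hT, Finset.mul_sum]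
  have h1' : |∑ μ, (∑ ν, inverseMetric M a x μ ν * p ν) * fderiv ℝ (radius a) x (E4.basisVector μ)| ≤
      4 * ((1 + Bs.bound) * T * D) := by
    calc _ ≤ ∑ μ, |(∑ ν, inverseMetric M a x μ ν * p ν) * fderiv ℝ (radius a) x (E4.basisVector μ)| :=
          Finset.abs_sum_le_sum_abs _ _
      _ ≤ ∑ _μ : Fin 4, (1 + Bs.bound) * T * D := Finset.sum_le_sum fun μ _ ↦ by
          rw [abs_mul]
          exact mul_le_mul (hAμ μ) (hDb x h1 h2 μ) (abs_nonneg _) (by positivity)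
      _ = 4 * ((1 + Bs.bound) * T * D) := by
          simp only [Finset.sum_const, Finset.card_univ, Fintype.card_fin, nsmul_eq_mul, Nat.cast_ofNat]
  have h2' : |∑ α, axialComponents x α * p α| ≤ Ξ * T := by
    calc _ ≤ ∑ α, |axialComponents x α * p α| := Finset.abs_sum_le_sum_abs _ _
      _ ≤ ∑ α, Ξ * |p α| := Finset.sum_le_sum fun α _ ↦ by
          rw [abs_mul]; exact mul_le_mul_of_nonneg_right (hΞb x h1 h2 α) (abs_nonneg _)
      _ = Ξ * T := by rw [hT, Finset.mul_sum]
  rw [abs_mul]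
  calc |∑ μ, (∑ ν, inverseMetric M a x μ ν * p ν) * fderiv ℝ (radius a) x (E4.basisVector μ)| *
        |∑ α, axialComponents x α * p α|
      ≤ 4 * ((1 + Bs.bound) * T * D) * (Ξ * T) :=
        mul_le_mul h1' h2' (abs_nonneg _) (by positivity)
    _ = 4 * (1 + Bs.bound) * D * Ξ * T ^ 2 := by ring
    _ ≤ 4 * (1 + Bs.bound) * D * Ξ * (4 * S) := by gcongr
    _ = 16 * (1 + Bs.bound) * D * Ξ * S := by ring


/-! ## Part 6. The energy estimate of `T + Ω(r)Φ` between graph leaves for functions supported in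
a radial slab -/

/-- **The components of `T + Ω(r)Φ` are bounded on a radial slab** `{A₀ ≤ r ≤ A₁}`, `A₀ > 0`
(continuity on `{r > 0}`, `t*`-invariance, compactness of `{x⁰ = 0} ∩ slab`). [folklore] -/
theorem exists_abs_helicalVector_le (a : ℝ) {A₀ A₁ : ℝ} (hA₀ : 0 < A₀) {Ω : ℝ → ℝ}
    (hΩ : ContDiff ℝ 1 Ω) :
    ∃ Ξ : ℝ, 0 ≤ Ξ ∧ ∀ x : E4, A₀ ≤ radius a x → radius a x ≤ A₁ →
      ∀ α, |helicalVector a Ω x α| ≤ Ξ := by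
  have hΞ : ∀ α, ∃ C : ℝ, ∀ x : E4, A₀ ≤ radius a x → radius a x ≤ A₁ →
      |helicalVector a Ω x α| ≤ C := fun α ↦
    exists_forall_abs_le_of_continuousOn_slab a hA₀ (fun x ↦ helicalVector a Ω x α)
      (fun x hx ↦ (contDiffAt_helicalVector a hΩ hx α).continuousAt.continuousWithinAt)
      (fun x t ↦ helicalVector_add_smul_basisVector_zero a Ω x t α)
  choose Cα hCα using hΞ
  refine ⟨max 0 (Finset.univ.sup' Finset.univ_nonempty Cα), le_max_left _ _, fun x h1 h2 α ↦ ?_⟩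
  exact (hCα α x h1 h2).trans ((Finset.le_sup' Cα (Finset.mem_univ α)).trans (le_max_right _ _))

/-- **The `T + Ω(r)Φ`-energy estimate between graph leaves for functions supported in a radial
slab** (the energy identity of Dafermos–Rodnianski–Shlapentokh-Rothman arXiv:1402.7034,
Prop. 13.1.2, for the vector fields `V_i = T + Ω_i(r)Φ`, in the ingoing Kerr–Schild chart; the
leaves at parameter `0` and `s`). Let `(M, a)` be subextremal, `r₊ < A₀`, `Ω ∈ C¹` with
`T + Ω(r)Φ` timelike on the slab `{A₀ ≤ r ≤ A₁}` and `|Ω(r)|√(r² + a²) < 1` for `A₀ ≤ r ≤ A₁`, and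
`0 < c ≤ 1`. There are `b > 0`, `C ≥ 0` such that for every `C²` height `F` of slope
`∑(∂_iF)² ≤ (1 − c)²`, every `w ∈ C²(ℝ⁴)` vanishing off the slab (no equation is assumed:
`□_g w` enters as a source) and every `s ≥ 0`, writing `E(t) = ∫ ∑_μ (∂_μw)²(t + F(y), y) dy` and
`Err = ∫_{(0,s]} ∫ (|□_g w| ∑_μ|∂_μw| + |Ω'(r)| ∑_μ(∂_μw)²)(u + F(y), y) dy du`:
`b E(s) ≤ C E(0) + C Err` and `b E(0) ≤ C E(s) + C Err`. Proof: the energy inequality along the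
graph foliation `E4.graphFlux_add_integral_le_of_divergence_le` for the currents `∓J^X[w]`,
`X = T + Ω(r)Φ`, whose divergence `∓((□_g w) X(w) + K^X[w])` is bounded by
`Ξ |□_g w| ∑|∂w| + |Ω'(r)| C_K ∑(∂w)²` (`exists_abs_multiplierBulk_helicalVector_le`: `T`, `Φ`
Killing), and whose flux through the leaves is comparable to `∑(∂w)²`
(`exists_helicalEnergy_coercive`, `exists_abs_helicalFlux_le`). [cite: DafermosRodnianskiShlapentokhrothman2014, §13.1.4] -/
theorem shell_helicalEnergy_estimate_zero (hMa : IsSubextremal M a) {A₀ A₁ : ℝ}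
    (hA₀ : rPlus M a < A₀) {Ω : ℝ → ℝ} (hΩ : ContDiff ℝ 1 Ω)
    (htl : ∀ x : E4, A₀ ≤ radius a x → radius a x ≤ A₁ →
      bilin M a x (helicalVec a Ω x) (helicalVec a Ω x) < 0)
    (hco : ∀ r : ℝ, A₀ ≤ r → r ≤ A₁ → |Ω r| * √(r ^ 2 + a ^ 2) < 1)
    {c : ℝ} (hc : 0 < c) (hc1 : c ≤ 1) :
    ∃ b C : ℝ, 0 < b ∧ 0 ≤ C ∧
      ∀ (F : E3 → ℝ), ContDiff ℝ 2 F → (∀ y, ∑ i, partialE3 F y i ^ 2 ≤ (1 - c) ^ 2) →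
      ∀ w : E4 → ℝ, ContDiff ℝ 2 w → (∀ x, w x ≠ 0 → A₀ ≤ radius a x ∧ radius a x ≤ A₁) →
      ∀ s : ℝ, 0 ≤ s →
        b * (∫ y, ∑ μ, fderiv ℝ w (E4.ofTimeSpace (s + F y) y) (E4.basisVector μ) ^ 2) ≤
            C * (∫ y, ∑ μ, fderiv ℝ w (E4.ofTimeSpace (0 + F y) y) (E4.basisVector μ) ^ 2) +
              C * ∫ u in Set.Ioc 0 s, ∫ y,
                (|KerrSchild.waveOperator (inverseMetric M a) w (E4.ofTimeSpace (u + F y) y)| *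
                    ∑ μ, |fderiv ℝ w (E4.ofTimeSpace (u + F y) y) (E4.basisVector μ)| +
                  |deriv Ω (radius a (E4.ofTimeSpace (u + F y) y))| *
                    ∑ μ, fderiv ℝ w (E4.ofTimeSpace (u + F y) y) (E4.basisVector μ) ^ 2) ∧
        b * (∫ y, ∑ μ, fderiv ℝ w (E4.ofTimeSpace (0 + F y) y) (E4.basisVector μ) ^ 2) ≤
            C * (∫ y, ∑ μ, fderiv ℝ w (E4.ofTimeSpace (s + F y) y) (E4.basisVector μ) ^ 2) +
              C * ∫ u in Set.Ioc 0 s, ∫ y,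
                (|KerrSchild.waveOperator (inverseMetric M a) w (E4.ofTimeSpace (u + F y) y)| *
                    ∑ μ, |fderiv ℝ w (E4.ofTimeSpace (u + F y) y) (E4.basisVector μ)| +
                  |deriv Ω (radius a (E4.ofTimeSpace (u + F y) y))| *
                    ∑ μ, fderiv ℝ w (E4.ofTimeSpace (u + F y) y) (E4.basisVector μ) ^ 2) := by
  -- ### constants
  have hrp : 0 < rPlus M a := hMa.rPlus_pos
  have hA₀pos : 0 < A₀ := hrp.trans hA₀
  obtain ⟨b, hb, hcoer⟩ := exists_helicalEnergy_coercive hMa hA₀ hΩ.continuous htl hco hc hc1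
  obtain ⟨CF, hCF0, hCF⟩ := exists_abs_helicalFlux_le hMa hA₀ hΩ (A₁ := A₁)
  obtain ⟨CK, hCK0, hCK⟩ := exists_abs_multiplierBulk_helicalVector_le hMa hA₀ hΩ (A₁ := A₁)
  obtain ⟨Ξ, hΞ0, hΞ⟩ := exists_abs_helicalVector_le a hA₀pos hΩ (A₁ := A₁)
  set C : ℝ := CF + Ξ + CK + 1 with hCdef
  have hC0 : 0 ≤ C := by positivity
  have hCF_le : CF ≤ C := by rw [hCdef]; linarith
  have hΞ_le : Ξ ≤ C := by rw [hCdef]; linarith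
  have hCK_le : CK ≤ C := by rw [hCdef]; linarith
  refine ⟨b, C, hb, hC0, fun F hF hFc w hw hsupp s hs ↦ ?_⟩
  -- ### notation
  set G : E4 → Fin 4 → Fin 4 → ℝ := inverseMetric M a with hGdef
  set X : E4 → Fin 4 → ℝ := helicalVector a Ω with hXdef
  set U : Set E4 := {x | 0 < radius a x} with hU
  set Ksh : Set E4 := {x | A₀ ≤ radius a x ∧ radius a x ≤ A₁} with hKsh
  set ρ : ℝ := √(A₁ ^ 2 + a ^ 2) with hρ
  set pd : E4 → Fin 4 → ℝ := fun x κ ↦ fderiv ℝ w x (E4.basisVector κ) with hpd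
  set p2 : E4 → ℝ := fun x ↦ ∑ μ, pd x μ ^ 2 with hp2
  set T1 : E4 → ℝ := fun x ↦ ∑ μ, |pd x μ| with hT1
  set box : E4 → ℝ := KerrSchild.waveOperator G w with hbox
  set Kb : E4 → ℝ := KerrSchild.multiplierBulk G X w with hKb
  set Xw : E4 → ℝ := fun x ↦ ∑ α, X x α * pd x α with hXw
  set g : E4 → ℝ := fun x ↦ |box x| * T1 x + |deriv Ω (radius a x)| * p2 x with hg
  set e : E4 → ℝ := fun x ↦ Ξ * (|box x| * T1 x) + CK * (|deriv Ω (radius a x)| * p2 x) with he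
  set J : Fin 4 → E4 → ℝ := fun μ x ↦ -KerrSchild.multiplierCurrent G X w x μ with hJ
  set J' : Fin 4 → E4 → ℝ := fun μ x ↦ KerrSchild.multiplierCurrent G X w x μ with hJ'
  have hp2nn : ∀ x, 0 ≤ p2 x := fun x ↦ Finset.sum_nonneg fun μ _ ↦ sq_nonneg _
  have hT1nn : ∀ x, 0 ≤ T1 x := fun x ↦ Finset.sum_nonneg fun μ _ ↦ abs_nonneg _
  have hgnn : ∀ x, 0 ≤ g x := fun x ↦
    add_nonneg (mul_nonneg (abs_nonneg _) (hT1nn x)) (mul_nonneg (abs_nonneg _) (hp2nn x))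
  have he0 : ∀ x, 0 ≤ e x := fun x ↦ add_nonneg (mul_nonneg hΞ0 (mul_nonneg (abs_nonneg _) (hT1nn x)))
    (mul_nonneg hCK0 (mul_nonneg (abs_nonneg _) (hp2nn x)))
  have heg : ∀ x, e x ≤ C * g x := by
    intro x
    have h1 : Ξ * (|box x| * T1 x) ≤ C * (|box x| * T1 x) :=
      mul_le_mul_of_nonneg_right hΞ_le (mul_nonneg (abs_nonneg _) (hT1nn x))
    have h2 : CK * (|deriv Ω (radius a x)| * p2 x) ≤ C * (|deriv Ω (radius a x)| * p2 x) :=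
      mul_le_mul_of_nonneg_right hCK_le (mul_nonneg (abs_nonneg _) (hp2nn x))
    simp only [he, hg, mul_add]
    linarith
  -- ### the support
  have hUo : IsOpen U := isOpen_lt continuous_const (continuous_radius a)
  have hKc : IsClosed Ksh := by
    rw [hKsh, Set.setOf_and]
    exact (isClosed_le continuous_const (continuous_radius a)).inter
      (isClosed_le (continuous_radius a) continuous_const)
  have hKU : Ksh ⊆ U := fun x hx ↦ hA₀pos.trans_le hx.1
  have hw0 : ∀ x, x ∉ Ksh → w x = 0 := fun x hx ↦ by
    by_contra h
    exact hx (hsupp x h)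
  have hdw0 : ∀ x, x ∉ Ksh → fderiv ℝ w x = 0 := fun x hx ↦
    fderiv_eq_zero_of_forall_mem_eq_zero hKc.isOpen_compl hw0 hx
  have hpd0 : ∀ x, x ∉ Ksh → ∀ κ, pd x κ = 0 := fun x hx κ ↦ by
    simp only [hpd, hdw0 x hx, zero_apply]
  have hp20 : ∀ x, x ∉ Ksh → p2 x = 0 := fun x hx ↦ by
    simp only [hp2, hpd0 x hx, ne_eq, OfNat.ofNat_ne_zero, not_false_eq_true, zero_pow,
      Finset.sum_const_zero]
  have hT10 : ∀ x, x ∉ Ksh → T1 x = 0 := fun x hx ↦ by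
    simp only [hT1, hpd0 x hx, abs_zero, Finset.sum_const_zero]
  have hbox0 : ∀ x, x ∉ Ksh → box x = 0 := by
    intro x hx
    simp only [hbox, KerrSchild.waveOperator]
    refine Finset.sum_eq_zero fun μ _ ↦ ?_
    have hz : ∀ y ∈ Kshᶜ, (∑ ν, G y μ ν * fderiv ℝ w y (E4.basisVector ν)) = 0 := fun y hy ↦
      Finset.sum_eq_zero fun ν _ ↦ by rw [hdw0 y hy, zero_apply, mul_zero]
    rw [fderiv_eq_zero_of_forall_mem_eq_zero hKc.isOpen_compl hz hx, zero_apply]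
  have hJz : ∀ μ x, x ∉ Ksh → J μ x = 0 := fun μ x hx ↦ by
    simp only [hJ, KerrSchild.multiplierCurrent_eq_zero_of_fderiv_eq_zero G X (hdw0 x hx) μ, neg_zero]
  have hJ'z : ∀ μ x, x ∉ Ksh → J' μ x = 0 := fun μ x hx ↦ by
    simp only [hJ', KerrSchild.multiplierCurrent_eq_zero_of_fderiv_eq_zero G X (hdw0 x hx) μ]
  -- spatial bound on the slab
  have hρK : ∀ x ∈ Ksh, E4.spatialNorm x ≤ ρ := by
    intro x hx
    have hxpos : 0 < radius a x := hA₀pos.trans_le hx.1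
    have h1 := spatialNorm_sq_le hxpos (a := a)
    have h2 : radius a x ^ 2 ≤ A₁ ^ 2 := pow_le_pow_left₀ hxpos.le hx.2 2
    have h3 : E4.spatialNorm x ^ 2 ≤ A₁ ^ 2 + a ^ 2 := by linarith
    rw [hρ]
    calc E4.spatialNorm x = √(E4.spatialNorm x ^ 2) := (Real.sqrt_sq (E4.spatialNorm_nonneg x)).symm
      _ ≤ √(A₁ ^ 2 + a ^ 2) := Real.sqrt_le_sqrt h3
  -- ### regularity
  have hJ'1 : ∀ μ, ContDiff ℝ 1 (J' μ) := fun μ ↦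
    contDiff_of_contDiffAt_of_eq_zero hKc hKU
      (fun x hx ↦ contDiffAt_helicalCurrent M a hΩ hw.contDiffAt hx μ) (hJ'z μ)
  have hJ1 : ∀ μ, ContDiff ℝ 1 (J μ) := fun μ ↦ by
    have : J μ = fun x ↦ -J' μ x := rfl
    rw [this]
    exact (hJ'1 μ).neg
  have hpdc : ∀ κ, Continuous fun x ↦ pd x κ := fun κ ↦
    (KerrSchild.contDiff_fderiv_apply_basisVector hw κ).continuous
  have hp2c : Continuous p2 := continuous_finsetSum _ fun μ _ ↦ (hpdc μ).pow 2
  have hT1c : Continuous T1 := continuous_finsetSum _ fun μ _ ↦ (hpdc μ).abs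
  have hboxc : Continuous box :=
    continuous_of_continuousAt_of_eq_zero hKc hKU
      (fun x hx ↦ continuousAt_waveOperator M a hw.contDiffAt hx) hbox0
  have hΩ'c : Continuous fun x : E4 ↦ deriv Ω (radius a x) :=
    (hΩ.continuous_deriv le_rfl).comp (continuous_radius a)
  have hgc : Continuous g := (hboxc.abs.mul hT1c).add (hΩ'c.abs.mul hp2c)
  have hec : Continuous e :=
    (continuous_const.mul (hboxc.abs.mul hT1c)).add (continuous_const.mul (hΩ'c.abs.mul hp2c))
  -- ### the divergence at the points of the slab
  have hdiv_eq : ∀ x ∈ Ksh, ∑ μ, fderiv ℝ (J' μ) x (E4.basisVector μ) = box x * Xw x + Kb x := by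
    intro x hx
    have hxpos : 0 < radius a x := hKU hx
    exact KerrSchild.sum_fderiv_multiplierCurrent
      (fun μ ν ↦ (contDiffAt_inverseMetric M a hxpos μ ν (n := 1)).differentiableAt one_ne_zero)
      (inverseMetric_symm M a x)
      (fun α ↦ (contDiffAt_helicalVector a hΩ hxpos α).differentiableAt one_ne_zero) hw.contDiffAt
  have habs : ∀ x ∈ Ksh, |box x * Xw x + Kb x| ≤ e x := by
    intro x hx
    have hXw : |Xw x| ≤ Ξ * T1 x := by
      calc |Xw x| ≤ ∑ α, |X x α * pd x α| := Finset.abs_sum_le_sum_abs _ _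
        _ ≤ ∑ α, Ξ * |pd x α| := Finset.sum_le_sum fun α _ ↦ by
            rw [abs_mul]; exact mul_le_mul_of_nonneg_right (hΞ x hx.1 hx.2 α) (abs_nonneg _)
        _ = Ξ * T1 x := by rw [hT1, Finset.mul_sum]
    have h1 : |box x * Xw x| ≤ Ξ * (|box x| * T1 x) := by
      rw [abs_mul]
      calc |box x| * |Xw x| ≤ |box x| * (Ξ * T1 x) := mul_le_mul_of_nonneg_left hXw (abs_nonneg _)
        _ = Ξ * (|box x| * T1 x) := by ring
    have h2 : |Kb x| ≤ CK * (|deriv Ω (radius a x)| * p2 x) := by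
      have h := hCK x hx.1 hx.2 w
      calc |Kb x| ≤ |deriv Ω (radius a x)| * (CK * p2 x) := h
        _ = CK * (|deriv Ω (radius a x)| * p2 x) := by ring
    calc |box x * Xw x + Kb x| ≤ |box x * Xw x| + |Kb x| := abs_add_le _ _
      _ ≤ e x := add_le_add h1 h2
  have hdivJ' : ∀ x ∈ Ksh, F (E4.spatial x) ≤ x 0 → x 0 ≤ s + F (E4.spatial x) →
      ∑ μ, fderiv ℝ (J' μ) x (E4.basisVector μ) ≤ -(fun _ : E4 ↦ (0 : ℝ)) x + e x := by
    intro x hx _ _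
    rw [hdiv_eq x hx, neg_zero, zero_add]
    exact (le_abs_self _).trans (habs x hx)
  have hdivJ : ∀ x ∈ Ksh, F (E4.spatial x) ≤ x 0 → x 0 ≤ s + F (E4.spatial x) →
      ∑ μ, fderiv ℝ (J μ) x (E4.basisVector μ) ≤ -(fun _ : E4 ↦ (0 : ℝ)) x + e x := by
    intro x hx _ _
    have h1 : ∀ μ, fderiv ℝ (J μ) x (E4.basisVector μ) = -fderiv ℝ (J' μ) x (E4.basisVector μ) := by
      intro μ
      have : J μ = fun y ↦ -J' μ y := rfl
      rw [this, fderiv_fun_neg, neg_apply]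
    simp only [h1, Finset.sum_neg_distrib]
    rw [hdiv_eq x hx, neg_zero, zero_add]
    exact (neg_le_abs _).trans (habs x hx)
  -- ### the energy inequalities along the graph foliation
  have hρK' : ∀ x ∈ Ksh, F (E4.spatial x) ≤ x 0 → x 0 ≤ s + F (E4.spatial x) →
      E4.spatialNorm x ≤ ρ := fun x hx _ _ ↦ hρK x hx
  have hmain := E4.graphFlux_add_integral_le_of_divergence_le hKc hJ1 hJz hF hρK' continuous_const
    hec (fun _ _ ↦ rfl) he0 hdivJ hs le_rfl
  have hmain' := E4.graphFlux_add_integral_le_of_divergence_le hKc hJ'1 hJ'z hF hρK' continuous_const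
    hec (fun _ _ ↦ rfl) he0 hdivJ' hs le_rfl
  simp only [integral_zero, add_zero] at hmain hmain'
  -- ### the leaf flux density and its comparison with `∑ (∂w)²`
  set q : ℝ → E3 → ℝ := fun t y ↦
    ∑ μ, J μ (E4.ofTimeSpace (t + F y) y) * graphConormal F y μ with hq
  have hq' : ∀ t y, ∑ μ, J' μ (E4.ofTimeSpace (t + F y) y) * graphConormal F y μ = -q t y := by
    intro t y
    simp only [hq, hJ, hJ', neg_mul, Finset.sum_neg_distrib, neg_neg]
  have hqbd : ∀ t y, b * p2 (E4.ofTimeSpace (t + F y) y) ≤ q t y ∧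
      q t y ≤ CF * p2 (E4.ofTimeSpace (t + F y) y) := by
    intro t y
    set z := E4.ofTimeSpace (t + F y) y with hz
    have hqz : q t y = -∑ μ, KerrSchild.multiplierCurrent G X w z μ * graphConormal F y μ := by
      simp only [hq, hJ, neg_mul, Finset.sum_neg_distrib]
      rfl
    by_cases hzK : z ∈ Ksh
    · have hn : graphConormal F y ∈ slopeConormals c := graphConormal_mem_slopeConormals (hFc y)
      have hna : graphConormal F y ∈ admissibleConormals :=
        slopeConormals_subset_admissibleConormals hc.le hc1 hn
      refine ⟨?_, ?_⟩
      · rw [hqz]; exact hcoer z hzK.1 hzK.2 _ hn w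
      · rw [hqz]
        exact (neg_le_abs _).trans (hCF z hzK.1 hzK.2 _ hna w)
    · have hq0 : q t y = 0 := Finset.sum_eq_zero fun μ _ ↦ by
        have h0 : J μ (E4.ofTimeSpace (t + F y) y) = 0 := hJz μ _ hzK
        rw [h0, zero_mul]
      rw [hq0, hp20 z hzK, mul_zero, mul_zero]
      exact ⟨le_rfl, le_rfl⟩
  -- continuity / integrability on the ball
  have hgraph : ∀ t : ℝ, Continuous fun y : E3 ↦ E4.ofTimeSpace (t + F y) y := fun t ↦
    E4.continuous_ofTimeSpace' (continuous_const.add hF.continuous) continuous_id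
  have hgraph2 : Continuous fun p : ℝ × E3 ↦ E4.ofTimeSpace (p.1 + F p.2) p.2 :=
    E4.continuous_ofTimeSpace' (continuous_fst.add (hF.continuous.comp continuous_snd)) continuous_snd
  have hF1 : ContDiff ℝ 1 F := hF.of_le one_le_two
  have hnc : ∀ μ, Continuous fun y : E3 ↦ graphConormal F y μ := by
    intro μ
    refine Fin.cases ?_ (fun i ↦ ?_) μ
    · simp only [graphConormal_zero]; exact continuous_const
    · simp only [graphConormal_succ, partialE3]
      exact ((hF1.continuous_fderiv one_ne_zero).clm_apply continuous_const).neg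
  have hqc : ∀ t, Continuous (q t) := fun t ↦
    continuous_finsetSum _ fun μ _ ↦ ((hJ1 μ).continuous.comp (hgraph t)).mul (hnc μ)
  have hqi : ∀ t, IntegrableOn (q t) (closedBall (0 : E3) ρ) := fun t ↦
    (hqc t).continuousOn.integrableOn_compact (isCompact_closedBall _ _)
  have hp2i : ∀ t, IntegrableOn (fun y ↦ p2 (E4.ofTimeSpace (t + F y) y)) (closedBall (0 : E3) ρ) :=
    fun t ↦ (hp2c.comp (hgraph t)).continuousOn.integrableOn_compact (isCompact_closedBall _ _)
  -- off the ball everything vanishes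
  have hnotK : ∀ (t : ℝ) (y : E3), y ∉ closedBall (0 : E3) ρ → E4.ofTimeSpace (t + F y) y ∉ Ksh := by
    intro t y hy hK
    rw [mem_closedBall, dist_zero_right, not_le] at hy
    have h := hρK _ hK
    rw [E4.spatialNorm_ofTimeSpace] at h
    linarith
  have hE : ∀ t, (∫ y, p2 (E4.ofTimeSpace (t + F y) y)) =
      ∫ y in closedBall (0 : E3) ρ, p2 (E4.ofTimeSpace (t + F y) y) := fun t ↦
    (setIntegral_eq_integral_of_forall_compl_eq_zero fun y hy ↦ hp20 _ (hnotK t y hy)).symm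
  have hg0 : ∀ x, x ∉ Ksh → g x = 0 := fun x hx ↦ by
    simp only [hg, hbox0 x hx, hT10 x hx, hp20 x hx, abs_zero, mul_zero, add_zero]
  have hGI : ∀ u, (∫ y, g (E4.ofTimeSpace (u + F y) y)) =
      ∫ y in closedBall (0 : E3) ρ, g (E4.ofTimeSpace (u + F y) y) := fun u ↦
    (setIntegral_eq_integral_of_forall_compl_eq_zero fun y hy ↦ hg0 _ (hnotK u y hy)).symm
  -- lower and upper bounds of the fluxes
  have hlow : ∀ t, b * (∫ y, p2 (E4.ofTimeSpace (t + F y) y)) ≤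
      ∫ y in closedBall (0 : E3) ρ, q t y := by
    intro t
    rw [hE t, ← integral_const_mul]
    exact setIntegral_mono_on ((hp2i t).const_mul b) (hqi t) measurableSet_closedBall
      fun y _ ↦ (hqbd t y).1
  have hup : ∀ t, (∫ y in closedBall (0 : E3) ρ, q t y) ≤
      CF * ∫ y, p2 (E4.ofTimeSpace (t + F y) y) := by
    intro t
    rw [hE t, ← integral_const_mul]
    exact setIntegral_mono_on (hqi t) ((hp2i t).const_mul CF) measurableSet_closedBall
      fun y _ ↦ (hqbd t y).2
  -- the error integral
  have herr : (∫ u in Set.Ioc 0 s, ∫ y in closedBall (0 : E3) ρ, e (E4.ofTimeSpace (u + F y) y)) ≤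
      C * ∫ u in Set.Ioc 0 s, ∫ y, g (E4.ofTimeSpace (u + F y) y) := by
    rw [← integral_const_mul]
    have h1 : ∀ u, (∫ y in closedBall (0 : E3) ρ, e (E4.ofTimeSpace (u + F y) y)) ≤
        C * ∫ y, g (E4.ofTimeSpace (u + F y) y) := by
      intro u
      rw [hGI u, ← integral_const_mul]
      exact setIntegral_mono_on
        ((hec.comp (hgraph u)).continuousOn.integrableOn_compact (isCompact_closedBall _ _))
        (((hgc.comp (hgraph u)).continuousOn.integrableOn_compact (isCompact_closedBall _ _)).const_mul C)
        measurableSet_closedBall fun y _ ↦ heg _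
    have hc1' : Continuous fun u : ℝ ↦ ∫ y in closedBall (0 : E3) ρ, e (E4.ofTimeSpace (u + F y) y) :=
      continuous_parametric_integral_of_continuous (f := fun (u : ℝ) (y : E3) ↦
        e (E4.ofTimeSpace (u + F y) y)) (hec.comp hgraph2) (isCompact_closedBall _ _)
    have hc2' : Continuous fun u : ℝ ↦ C * ∫ y, g (E4.ofTimeSpace (u + F y) y) := by
      have h : Continuous fun u : ℝ ↦ ∫ y in closedBall (0 : E3) ρ, g (E4.ofTimeSpace (u + F y) y) :=
        continuous_parametric_integral_of_continuous (f := fun (u : ℝ) (y : E3) ↦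
          g (E4.ofTimeSpace (u + F y) y)) (hgc.comp hgraph2) (isCompact_closedBall _ _)
      simp only [hGI]
      exact continuous_const.mul h
    exact setIntegral_mono_on (hc1'.integrableOn_Icc.mono_set Set.Ioc_subset_Icc_self)
      (hc2'.integrableOn_Icc.mono_set Set.Ioc_subset_Icc_self) measurableSet_Ioc fun u _ ↦ h1 u
  -- ### conclusion
  have hfluxs : ∫ y in closedBall (0 : E3) ρ, ∑ μ, J μ (E4.ofTimeSpace (s + F y) y) *
      graphConormal F y μ = ∫ y in closedBall (0 : E3) ρ, q s y := rfl
  have hflux0 : ∫ y in closedBall (0 : E3) ρ, ∑ μ, J μ (E4.ofTimeSpace (0 + F y) y) *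
      graphConormal F y μ = ∫ y in closedBall (0 : E3) ρ, q 0 y := rfl
  have hflux's : ∫ y in closedBall (0 : E3) ρ, ∑ μ, J' μ (E4.ofTimeSpace (s + F y) y) *
      graphConormal F y μ = -∫ y in closedBall (0 : E3) ρ, q s y := by
    simp only [hq']; exact integral_neg _
  have hflux'0 : ∫ y in closedBall (0 : E3) ρ, ∑ μ, J' μ (E4.ofTimeSpace (0 + F y) y) *
      graphConormal F y μ = -∫ y in closedBall (0 : E3) ρ, q 0 y := by
    simp only [hq']; exact integral_neg _
  rw [hfluxs, hflux0] at hmain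
  rw [hflux's, hflux'0] at hmain'
  have hCE0 : CF * (∫ y, p2 (E4.ofTimeSpace (0 + F y) y)) ≤ C * ∫ y, p2 (E4.ofTimeSpace (0 + F y) y) :=
    mul_le_mul_of_nonneg_right hCF_le (integral_nonneg fun y ↦ hp2nn _)
  have hCEs : CF * (∫ y, p2 (E4.ofTimeSpace (s + F y) y)) ≤ C * ∫ y, p2 (E4.ofTimeSpace (s + F y) y) :=
    mul_le_mul_of_nonneg_right hCF_le (integral_nonneg fun y ↦ hp2nn _)
  constructor
  · have h1 := hlow s
    have h2 := hup 0
    linarith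
  · have h1 := hlow 0
    have h2 := hup s
    linarith


/-- **The `T + Ω(r)Φ`-energy estimate between the graph leaves `Σ̃_τ` and `Σ̃_{τ+s}`** (both time
directions) for `C²` functions supported in a radial slab — `shell_helicalEnergy_estimate_zero`
for the height `τ + F`, with the error written over `u ∈ (τ, τ + s]`. With `E(t)`, `g` as there:
`b E(τ + s) ≤ C E(τ) + C ∫_{(τ,τ+s]} ∫ g` and `b E(τ) ≤ C E(τ + s) + C ∫_{(τ,τ+s]} ∫ g`. This is the
form of the energy identity of the `V_i` used in DRSR arXiv:1402.7034, Prop. 13.1.2 (between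
`Σ_τ` and `Σ_{τ_n^{(i)}}`). [cite: DafermosRodnianskiShlapentokhrothman2014, §13.1.4] -/
theorem shell_helicalEnergy_estimate (hMa : IsSubextremal M a) {A₀ A₁ : ℝ}
    (hA₀ : rPlus M a < A₀) {Ω : ℝ → ℝ} (hΩ : ContDiff ℝ 1 Ω)
    (htl : ∀ x : E4, A₀ ≤ radius a x → radius a x ≤ A₁ →
      bilin M a x (helicalVec a Ω x) (helicalVec a Ω x) < 0)
    (hco : ∀ r : ℝ, A₀ ≤ r → r ≤ A₁ → |Ω r| * √(r ^ 2 + a ^ 2) < 1)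
    {c : ℝ} (hc : 0 < c) (hc1 : c ≤ 1) :
    ∃ b C : ℝ, 0 < b ∧ 0 ≤ C ∧
      ∀ (F : E3 → ℝ), ContDiff ℝ 2 F → (∀ y, ∑ i, partialE3 F y i ^ 2 ≤ (1 - c) ^ 2) →
      ∀ w : E4 → ℝ, ContDiff ℝ 2 w → (∀ x, w x ≠ 0 → A₀ ≤ radius a x ∧ radius a x ≤ A₁) →
      ∀ τ s : ℝ, 0 ≤ s →
        b * (∫ y, ∑ μ, fderiv ℝ w (E4.ofTimeSpace (τ + s + F y) y) (E4.basisVector μ) ^ 2) ≤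
            C * (∫ y, ∑ μ, fderiv ℝ w (E4.ofTimeSpace (τ + F y) y) (E4.basisVector μ) ^ 2) +
              C * ∫ u in Set.Ioc τ (τ + s), ∫ y,
                (|KerrSchild.waveOperator (inverseMetric M a) w (E4.ofTimeSpace (u + F y) y)| *
                    ∑ μ, |fderiv ℝ w (E4.ofTimeSpace (u + F y) y) (E4.basisVector μ)| +
                  |deriv Ω (radius a (E4.ofTimeSpace (u + F y) y))| *
                    ∑ μ, fderiv ℝ w (E4.ofTimeSpace (u + F y) y) (E4.basisVector μ) ^ 2) ∧
        b * (∫ y, ∑ μ, fderiv ℝ w (E4.ofTimeSpace (τ + F y) y) (E4.basisVector μ) ^ 2) ≤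
            C * (∫ y, ∑ μ, fderiv ℝ w (E4.ofTimeSpace (τ + s + F y) y) (E4.basisVector μ) ^ 2) +
              C * ∫ u in Set.Ioc τ (τ + s), ∫ y,
                (|KerrSchild.waveOperator (inverseMetric M a) w (E4.ofTimeSpace (u + F y) y)| *
                    ∑ μ, |fderiv ℝ w (E4.ofTimeSpace (u + F y) y) (E4.basisVector μ)| +
                  |deriv Ω (radius a (E4.ofTimeSpace (u + F y) y))| *
                    ∑ μ, fderiv ℝ w (E4.ofTimeSpace (u + F y) y) (E4.basisVector μ) ^ 2) := by
  obtain ⟨b, C, hb, hC, h⟩ := shell_helicalEnergy_estimate_zero hMa hA₀ hΩ htl hco hc hc1 (A₁ := A₁)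
  refine ⟨b, C, hb, hC, fun F hF hFc w hw hsupp τ s hs ↦ ?_⟩
  -- the height `τ + F`
  have hF' : ContDiff ℝ 2 (fun y ↦ τ + F y) := contDiff_const.add hF
  have hFc' : ∀ y, ∑ i, partialE3 (fun y ↦ τ + F y) y i ^ 2 ≤ (1 - c) ^ 2 := fun y ↦ by
    have : ∀ i, partialE3 (fun y ↦ τ + F y) y i = partialE3 F y i := fun i ↦ by
      simp only [partialE3, fderiv_const_add]
    simp only [this]
    exact hFc y
  have h1 := h (fun y ↦ τ + F y) hF' hFc' w hw hsupp s hs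
  -- rewrite the leaves
  have hleaf_s : ∀ y, E4.ofTimeSpace (s + (τ + F y)) y = E4.ofTimeSpace (τ + s + F y) y := fun y ↦ by
    congr 1; ring
  have hleaf_0 : ∀ y, E4.ofTimeSpace (0 + (τ + F y)) y = E4.ofTimeSpace (τ + F y) y := fun y ↦ by
    congr 1; ring
  -- the substitution `u ↦ u + τ` in the error integral
  set gI : ℝ → ℝ := fun u ↦ ∫ y,
    (|KerrSchild.waveOperator (inverseMetric M a) w (E4.ofTimeSpace (u + F y) y)| *
        ∑ μ, |fderiv ℝ w (E4.ofTimeSpace (u + F y) y) (E4.basisVector μ)| +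
      |deriv Ω (radius a (E4.ofTimeSpace (u + F y) y))| *
        ∑ μ, fderiv ℝ w (E4.ofTimeSpace (u + F y) y) (E4.basisVector μ) ^ 2) with hgI
  have herr : (∫ u in Set.Ioc 0 s, ∫ y,
      (|KerrSchild.waveOperator (inverseMetric M a) w (E4.ofTimeSpace (u + (τ + F y)) y)| *
          ∑ μ, |fderiv ℝ w (E4.ofTimeSpace (u + (τ + F y)) y) (E4.basisVector μ)| +
        |deriv Ω (radius a (E4.ofTimeSpace (u + (τ + F y)) y))| *
          ∑ μ, fderiv ℝ w (E4.ofTimeSpace (u + (τ + F y)) y) (E4.basisVector μ) ^ 2)) =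
      ∫ u in Set.Ioc τ (τ + s), gI u := by
    have hshift : ∀ u y, E4.ofTimeSpace (u + (τ + F y)) y = E4.ofTimeSpace ((u + τ) + F y) y :=
      fun u y ↦ by congr 1; ring
    simp only [hshift]
    have h2 : (∫ u in Set.Ioc 0 s, gI (u + τ)) = ∫ u in Set.Ioc τ (τ + s), gI u := by
      rw [← intervalIntegral.integral_of_le hs, intervalIntegral.integral_comp_add_right gI τ,
        zero_add, show s + τ = τ + s from add_comm s τ,
        intervalIntegral.integral_of_le (by linarith : τ ≤ τ + s)]
    exact h2
  simp only [hleaf_s, hleaf_0] at h1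
  rw [herr] at h1
  exact h1

end Kerr

end Literature.Geometry.Lorentzian
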